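/-
Copyright (c) 2026. Released under Apache 2.0 license.

# Brundan–Kleshchev Thm 3.3: the braid relation in `R^{Λ₀}_n` (mixed residue patterns)

Continuation of `KLRGradedCellularBasisKLRAlgebra.lean` (which reached the size limit) towards
`Literature.RepresentationTheory.FiniteGroups.KLRGradedCellularBasis_holds`
[cite: HuMathas2010, Main Theorem] via [Brundan–Kleshchev, *Blocks of cyclotomic Hecke algebras and
Khovanov–Lauda algebras*, Invent. Math. 178 (2009), arXiv:0808.2032, Thm 3.3 and §3.4].

That file proves the length-three braid relation `s_rs_{r+1}s_r ē(𝐢) = s_{r+1}s_rs_{r+1} ē(𝐢)` for BK's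
Hecke generators `s_r ∈ R^{Λ₀}_n` when the three residues `i_r, i_{r+1}, i_{r+2}` are distinct and
when they are all equal.  Here we treat the mixed patterns `i_r = i_{r+1} ≠ i_{r+2}`
(`klrSR_braid_mul_klrIdemR_of_eq_ne`) and `i_r ≠ i_{r+1} = i_{r+2}`
(`klrSR_braid_mul_klrIdemR_of_ne_eq`), each in all four quiver configurations of the unequal pair,
by the same method: `ψ`-word normal forms of both sides (BK §3.4, "commute the `ψ`'s to the left"
using (2.9)), with the `∂`-data of the `q`-scalars through the idempotent with equal residues kept
as hypotheses of an `_aux` statement and discharged per quiver branch, and coefficient comparison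
in the commutative subalgebra `Y''`.

Then the pattern `i_r = i_{r+2} ≠ i_{r+1}` (`klrSR_braid_mul_klrIdemR_of_eq_far`, where (R7) has
the correction term `Z ∈ {ȳ_r - 2ȳ_{r+1} + ȳ_{r+2}, 1, -1, 0}` entering the coefficient of `ē(𝐢)`
through the identity `Q_r d_B q_r - Q_{r+1} d_D q_{r+1} + Z q_r q_{r+1} = p_r p_{r+1}(p_r - p_{r+1})`),
the assembly **`klrSR_braid : s_rs_{r+1}s_r = s_{r+1}s_rs_{r+1}`** (BK Thm 3.3 complete) and the
resulting **unconditional isomorphism `klrAlgEquiv : R^{Λ₀}_n ≃ₐ[k] k[S_n]`** (Brundan–Kleshchev's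
Main Theorem at level one, degenerate case), i.e. `σ` is bijective.

Then the transport (section `Transport`): the degree components
`groupAlgDegPart k p e := σ(R^{Λ₀}_{n,e})` of `k[S_n]` (independent, spanning, multiplicative;
`e(𝐢)`, `y_r`, `ψ_r e(𝐢)` homogeneous of degrees `0`, `2`, `-a_{i_r i_{r+1}}`), the graded blocks
`gradedBlock k p α e := k[S_n]_e ⊓ k[S_n]_α` (content `α`), which are multiplicative within a
content, orthogonal across contents, independent (`iSupIndep_gradedBlock`) and exhaustive
(`iSup_gradedBlock_eq_top`, `isInternal_gradedBlock`: **`k[S_n] = ⨁_{α,e} e_α k[S_n]_e`**, i.e. the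
blocks `e_α k[S_n]` are `ℤ`-graded algebras — Hu–Mathas Thm 24 for `𝔽_p S_n`); and the reduction
`KLRGradedCellularBasis_of_finrank_gradedBlock`: **the fact follows from the graded dimension
formula `dim e_α 𝔽_p[S_n]_e = #{(μ, 𝔰, 𝔱) : cont μ = α, deg 𝔰 + deg 𝔱 = e}`** (collect bases of the
graded blocks along `DirectSum.IsInternal.collectedBasis`).

Still missing towards `KLRGradedCellularBasis_holds`: that graded dimension formula, i.e. the
Hu–Mathas side (standard tableaux and their degrees, the homogeneous basis `ψ_{𝔰𝔱}` of
`e_α H_e` — Hu–Mathas 2010 §4–§5 — or Brundan–Kleshchev 2009a Thm 4.20).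
-/

import Literature.RepresentationTheory.FiniteGroups.KLRGradedCellularBasisKLRAlgebra

noncomputable section

open scoped BigOperators

namespace Literature.RepresentationTheory.FiniteGroups

open Equiv

/-! ### BK Thm 3.3, braid relation: the case `i_r = i_{r+1} ≠ i_{r+2}` -/

section BraidEqNe

variable (k : Type*) [Field k] (p n : ℕ) [Fact p.Prime] [CharP k p]

variable {p n}

omit [CharP k p] in
/-- A difference unit through `P_r(𝐢)` when `i_r = i_{r+1}`, left position `r`:
`(c + ȳ_r - ȳ_t) P_r(𝐢) = P_r(𝐢)(c + ȳ_{r+1} - ȳ_t) - ē(𝐢)` (`t ≠ r, r+1`). [folklore] -/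
theorem klrDiffUnitR_left_mul_klrPsiR_of_eq {r r' t : Fin n} (h : (r' : ℕ) = r + 1) {i : Fin n → ZMod p}
    (hab : i r = i r') (ht : t ≠ r) (ht' : t ≠ r') (c : k) :
    klrDiffUnitR k r t c * klrPsiR k r i = klrPsiR k r i * klrDiffUnitR k r' t c + (0 - klrIdemR k i) := by
  rw [klrDiffUnitR_mul_klrPsiR_rule k h i r t c, swap_apply_left, swap_apply_of_ne_of_ne ht ht',
    klrDelta_left k h hab, klrDelta_of_ne_of_ne k ht ht']
  abel

omit [CharP k p] in
/-- Same, right position `r+1`: `(c + ȳ_{r+1} - ȳ_t) P_r(𝐢) = P_r(𝐢)(c + ȳ_r - ȳ_t) + ē(𝐢)`. [folklore] -/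
theorem klrDiffUnitR_right_mul_klrPsiR_of_eq {r r' t : Fin n} (h : (r' : ℕ) = r + 1) {i : Fin n → ZMod p}
    (hab : i r = i r') (ht : t ≠ r) (ht' : t ≠ r') (c : k) :
    klrDiffUnitR k r' t c * klrPsiR k r i = klrPsiR k r i * klrDiffUnitR k r t c + klrIdemR k i := by
  rw [klrDiffUnitR_mul_klrPsiR_rule k h i r' t c, swap_apply_right, swap_apply_of_ne_of_ne ht ht',
    klrDelta_right k hab, klrDelta_of_ne_of_ne k ht ht', sub_zero]

/-- **`p_{r+1,r+2}(𝐢) P_r(𝐢) = P_r(𝐢) p_{r,r+2}(𝐢) - ē(𝐢) p_{r+1,r+2} p_{r,r+2}`** (`i_r = i_{r+1} ≠ i_{r+2}`). [folklore] -/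
theorem klrPR_next_mul_klrPsiR_of_eq_ne {r r' r'' : Fin n} (h : (r' : ℕ) = r + 1) (h' : (r'' : ℕ) = r' + 1)
    {i : Fin n → ZMod p} (hab : i r = i r') (hac : i r ≠ i r'') :
    klrPR k r' r'' i * klrPsiR k r i =
      klrPsiR k r i * klrPR k r r'' i - klrIdemR k i * (klrPR k r' r'' i * klrPR k r r'' i) := by
  have h1 : r'' ≠ r := by intro e; rw [Fin.ext_iff] at e; omega
  have h2 : r'' ≠ r' := by intro e; rw [Fin.ext_iff] at e; omega
  have hbc : i r' ≠ i r'' := fun e => hac (hab.trans e)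
  have hc : resK k (i r') - resK k (i r'') ≠ 0 := resK_sub_ne_zero k hbc
  have hrule := klrDiffUnitR_right_mul_klrPsiR_of_eq k h hab h1 h2 (resK k (i r') - resK k (i r''))
  have hinv := ringInverse_mul_of_rule hrule (isUnit_klrDiffUnitR k _ _ hc) (isUnit_klrDiffUnitR k _ _ hc)
  have e1 : klrPR k r' r'' i = Ring.inverse (klrDiffUnitR k r' r'' (resK k (i r') - resK k (i r''))) := if_neg hbc
  have e2 : klrPR k r r'' i = Ring.inverse (klrDiffUnitR k r r'' (resK k (i r') - resK k (i r''))) := by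
    rw [← hab]; exact if_neg hac
  have hmem2 := ringInverse_mem_klrYAlg k
    (klrDiffUnitR_mem_klrYAlg k (p := p) (n := n) r' r'' (resK k (i r') - resK k (i r''))) (isUnit_klrDiffUnitR k _ _ hc)
  rw [e1, e2, hinv, ← klrIdemR_mul_of_mem_klrYAlg k hmem2 i, mul_assoc]

/-- **`p_{r,r+2}(𝐢) P_r(𝐢) = P_r(𝐢) p_{r+1,r+2}(𝐢) + ē(𝐢) p_{r,r+2} p_{r+1,r+2}`** (`i_r = i_{r+1} ≠ i_{r+2}`). [folklore] -/
theorem klrPR_far_mul_klrPsiR_of_eq_ne {r r' r'' : Fin n} (h : (r' : ℕ) = r + 1) (h' : (r'' : ℕ) = r' + 1)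
    {i : Fin n → ZMod p} (hab : i r = i r') (hac : i r ≠ i r'') :
    klrPR k r r'' i * klrPsiR k r i =
      klrPsiR k r i * klrPR k r' r'' i + klrIdemR k i * (klrPR k r r'' i * klrPR k r' r'' i) := by
  have h1 : r'' ≠ r := by intro e; rw [Fin.ext_iff] at e; omega
  have h2 : r'' ≠ r' := by intro e; rw [Fin.ext_iff] at e; omega
  have hbc : i r' ≠ i r'' := fun e => hac (hab.trans e)
  have hc : resK k (i r') - resK k (i r'') ≠ 0 := resK_sub_ne_zero k hbc
  have hrule := klrDiffUnitR_left_mul_klrPsiR_of_eq k h hab h1 h2 (resK k (i r') - resK k (i r''))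
  have hinv := ringInverse_mul_of_rule hrule (isUnit_klrDiffUnitR k _ _ hc) (isUnit_klrDiffUnitR k _ _ hc)
  have e1 : klrPR k r' r'' i = Ring.inverse (klrDiffUnitR k r' r'' (resK k (i r') - resK k (i r''))) := if_neg hbc
  have e2 : klrPR k r r'' i = Ring.inverse (klrDiffUnitR k r r'' (resK k (i r') - resK k (i r''))) := by
    rw [← hab]; exact if_neg hac
  have hmem := ringInverse_mem_klrYAlg k
    (klrDiffUnitR_mem_klrYAlg k (p := p) (n := n) r r'' (resK k (i r') - resK k (i r''))) (isUnit_klrDiffUnitR k _ _ hc)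
  rw [e1, e2, hinv]
  simp only [mul_sub, sub_mul, mul_zero, zero_mul]
  rw [← klrIdemR_mul_of_mem_klrYAlg k hmem i, mul_assoc]
  abel

section
variable {r r' r'' : Fin n} (h : (r' : ℕ) = r + 1) (h' : (r'' : ℕ) = r' + 1) {i : Fin n → ZMod p}
  (hab : i r = i r') (hac : i r ≠ i r'')
include h h' hab hac

/-- `s_{r+1} P_r(𝐢)` for `i_r = i_{r+1} ≠ i_{r+2}`, given the `∂`-datum `d₂` of `q_{r+1,r+2}`. [folklore] -/
theorem klrSR_next_mul_klrPsiR_of_eq_ne {d2 : KLRAlgebra k p n}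
    (hq2 : klrQR k r' r'' i * klrPsiR k r i = klrPsiR k r i * klrQR k r r'' i + klrIdemR k i * d2) :
    klrSR k r' r'' * klrPsiR k r i =
      klrPsiR k r' i * klrPsiR k r i * klrQR k r r'' i + klrPsiR k r' i * d2 - klrPsiR k r i * klrPR k r r'' i +
        klrIdemR k i * (klrPR k r' r'' i * klrPR k r r'' i) := by
  rw [klrSR_mul_of_top k i (klrIdemR_mul_klrPsiR_of_eq k h hab), hq2, klrPR_next_mul_klrPsiR_of_eq_ne k h h' hab hac,
    mul_add, ← mul_assoc, ← mul_assoc, klrPsiR_mul_klrIdemR_self]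
  abel

/-- `s_r P_{r+1}(𝐢)` for `i_r = i_{r+1} ≠ i_{r+2}`. [folklore] -/
theorem klrSR_mul_klrPsiR_next_of_eq_ne :
    klrSR k r r' * klrPsiR k r' i =
      klrPsiR k r (i ∘ swap r' r'') * klrPsiR k r' i * klrQR k r r'' i - klrPsiR k r' i * klrPR k r r'' i :=
  klrSR_mul_klrPsiR_next k h h' (fun e => hac (hab.trans e))

/-- `s_r (P_{r+1}P_r)(𝐢)` for `i_r = i_{r+1} ≠ i_{r+2}`, given the `∂`-datum `d₁₃` of `q_{r,r+2}`. [folklore] -/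
theorem klrSR_mul_klrPsiR_two_one_of_eq_ne {d13 : KLRAlgebra k p n}
    (hq13 : klrQR k r r'' i * klrPsiR k r i = klrPsiR k r i * klrQR k r' r'' i + klrIdemR k i * d13) :
    klrSR k r r' * (klrPsiR k r' i * klrPsiR k r i) =
      klrPsiR k r (i ∘ swap r' r'') * klrPsiR k r' i * klrPsiR k r i * klrQR k r' r'' i +
        klrPsiR k r (i ∘ swap r' r'') * klrPsiR k r' i * d13 -
        klrPsiR k r' i * klrPsiR k r i * klrPR k r' r'' i -
        klrPsiR k r' i * (klrPR k r r'' i * klrPR k r' r'' i) := by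
  have t1 : klrPsiR k r (i ∘ swap r' r'') * klrPsiR k r' i * klrQR k r r'' i * klrPsiR k r i =
      klrPsiR k r (i ∘ swap r' r'') * klrPsiR k r' i * (klrPsiR k r i * klrQR k r' r'' i + klrIdemR k i * d13) := by
    rw [mul_assoc, hq13]
  have t2 : klrPsiR k r' i * klrPR k r r'' i * klrPsiR k r i =
      klrPsiR k r' i * (klrPsiR k r i * klrPR k r' r'' i + klrIdemR k i * (klrPR k r r'' i * klrPR k r' r'' i)) := by
    rw [mul_assoc, klrPR_far_mul_klrPsiR_of_eq_ne k h h' hab hac]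
  rw [← mul_assoc, klrSR_mul_klrPsiR_next_of_eq_ne k h h' hab hac, sub_mul, t1, t2]
  simp only [mul_add, ← mul_assoc]
  rw [mul_assoc (klrPsiR k r _) (klrPsiR k r' i) (klrIdemR k i), klrPsiR_mul_klrIdemR_self]
  simp only [mul_assoc]
  abel

omit h' hac in
/-- `s_r P_r(𝐢) = P_r(𝐢)` for `i_r = i_{r+1}`. [folklore] -/
theorem klrSR_mul_klrPsiR_of_eq' : klrSR k r r' * klrPsiR k r i = klrPsiR k r i := by
  rw [klrSR_mul_of_top_eq k r' hab (klrIdemR_mul_klrPsiR_of_eq k h hab), klrQR_mul_klrPsiR_self_of_eq k h hab,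
    mul_add, ← mul_assoc, klrPsiR_mul_self_of_eq k h hab, zero_mul, zero_add, mul_add, klrPsiR_mul_klrIdemR_self]
  abel

/-- `s_{r+1} (P_r(s_{r+1}𝐢) P_{r+1}(𝐢)) = P_rP_{r+1}P_r(𝐢) q_r(𝐢) - P_r(s_{r+1}𝐢)P_{r+1}(𝐢)` for
`i_r = i_{r+1} ≠ i_{r+2}` (top idempotent has equal residues at `r+1, r+2`; (R7) is exact here). [folklore] -/
theorem klrSR_next_mul_klrPsiR_one_two_of_eq_ne :
    klrSR k r' r'' * (klrPsiR k r (i ∘ swap r' r'') * klrPsiR k r' i) =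
      klrPsiR k r (i ∘ swap r' r'') * klrPsiR k r' i * klrPsiR k r i * klrQR k r r' i -
        klrPsiR k r (i ∘ swap r' r'') * klrPsiR k r' i := by
  have h1 : r ≠ r' := by intro e; rw [Fin.ext_iff] at e; omega
  have h2 : r ≠ r'' := by intro e; rw [Fin.ext_iff] at e; omega
  have h3 : r'' ≠ r' := by intro e; rw [Fin.ext_iff] at e; omega
  have hbc : i r' ≠ i r'' := fun e => hac (hab.trans e)
  set j := i ∘ swap r' r'' with hj
  have hjc : j r ≠ j r' := by
    simp only [hj, Function.comp_apply, swap_apply_left, swap_apply_of_ne_of_ne h1 h2]; exact hac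
  have hm : (j ∘ swap r r') r' = (j ∘ swap r r') r'' := by
    simp only [hj, Function.comp_apply, swap_apply_right, swap_apply_of_ne_of_ne h2.symm h3,
      swap_apply_of_ne_of_ne h1 h2]
    exact hab
  have htop : klrIdemR k (j ∘ swap r r') * (klrPsiR k r j * klrPsiR k r' i) = klrPsiR k r j * klrPsiR k r' i := by
    rw [← mul_assoc, klrIdemR_swap_mul_klrPsiR k h]
  rw [klrSR_mul_of_top k _ htop, klrPR_of_eq k hm, one_mul, ← mul_assoc (klrQR k r' r'' _),
    klrQR_mul_klrPsiR_of_ne k h hjc, mul_assoc, klrQR_mul_klrPsiR_of_ne k h' hbc]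
  simp only [swap_apply_right, swap_apply_of_ne_of_ne h2.symm h3, comp_swap_comp_swap, hj,
    swap_apply_of_ne_of_ne h1 h2]
  -- (R7) without correction
  have hbr := klrPsiR_braid k h h' i
  rw [comp_swap_eq_self_of_eq hab, if_neg (fun hh => hac hh.1), zero_mul, add_zero] at hbr
  simp only [← mul_assoc]
  rw [← hbr]

omit h in
/-- `s_{r+1} P_{r+1}(𝐢) = ē(𝐢) Q q_{r+2,r+1} - P_{r+1}(𝐢) p_{r+2,r+1}` for `i_{r+1} ≠ i_{r+2}`. [folklore] -/
theorem klrSR_next_mul_klrPsiR_next_of_ne :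
    klrSR k r' r'' * klrPsiR k r' i =
      klrIdemR k i * klrQQ k r' r'' i * klrQR k r'' r' i - klrPsiR k r' i * klrPR k r'' r' i := by
  have hbc : i r' ≠ i r'' := fun e => hac (hab.trans e)
  rw [klrSR_mul_klrPsiR_same k h' hbc, klrQR_rev_eq_klrQsR k hbc]

/-- **Normal form of `s_rs_{r+1}s_r ē(𝐢)` for `i_r = i_{r+1} ≠ i_{r+2}`.** [folklore] -/
theorem klrSR_triple_lhs_of_eq_ne {d2 d13 : KLRAlgebra k p n}
    (hq2 : klrQR k r' r'' i * klrPsiR k r i = klrPsiR k r i * klrQR k r r'' i + klrIdemR k i * d2)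
    (hq13 : klrQR k r r'' i * klrPsiR k r i = klrPsiR k r i * klrQR k r' r'' i + klrIdemR k i * d13) :
    klrSR k r r' * (klrSR k r' r'' * (klrSR k r r' * klrIdemR k i)) =
      (klrPsiR k r (i ∘ swap r' r'') * klrPsiR k r' i * klrPsiR k r i * klrQR k r' r'' i +
        klrPsiR k r (i ∘ swap r' r'') * klrPsiR k r' i * d13 -
        klrPsiR k r' i * klrPsiR k r i * klrPR k r' r'' i -
        klrPsiR k r' i * (klrPR k r r'' i * klrPR k r' r'' i)) * (klrQR k r r'' i * klrQR k r r' i) +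
      (klrPsiR k r (i ∘ swap r' r'') * klrPsiR k r' i * klrQR k r r'' i - klrPsiR k r' i * klrPR k r r'' i) *
        (d2 * klrQR k r r' i) -
      klrPsiR k r i * (klrPR k r r'' i * klrQR k r r' i) +
      (klrPsiR k r i * klrQR k r r' i - klrIdemR k i) * (klrPR k r' r'' i * klrPR k r r'' i * klrQR k r r' i) -
      (klrPsiR k r (i ∘ swap r' r'') * klrPsiR k r' i * klrQR k r r'' i - klrPsiR k r' i * klrPR k r r'' i) *
        klrQR k r' r'' i +
      (klrPsiR k r i * klrQR k r r' i - klrIdemR k i) * klrPR k r' r'' i := by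
  have A1 : klrSR k r r' * klrIdemR k i = klrPsiR k r i * klrQR k r r' i - klrIdemR k i := by
    rw [klrSR_mul_klrIdemR', klrPR_of_eq k hab, mul_one]
  have A2 : klrSR k r' r'' * (klrPsiR k r i * klrQR k r r' i - klrIdemR k i) =
      klrPsiR k r' i * klrPsiR k r i * (klrQR k r r'' i * klrQR k r r' i) + klrPsiR k r' i * (d2 * klrQR k r r' i) -
        klrPsiR k r i * (klrPR k r r'' i * klrQR k r r' i) +
        klrIdemR k i * (klrPR k r' r'' i * klrPR k r r'' i * klrQR k r r' i) -
        klrPsiR k r' i * klrQR k r' r'' i + klrIdemR k i * klrPR k r' r'' i := by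
    rw [mul_sub, ← mul_assoc, klrSR_next_mul_klrPsiR_of_eq_ne k h h' hab hac hq2, klrSR_mul_klrIdemR']
    simp only [sub_mul, add_mul, mul_assoc]
    abel
  rw [A1, A2]
  rw [mul_add, mul_sub, mul_add, mul_sub, mul_add, ← mul_assoc, klrSR_mul_klrPsiR_two_one_of_eq_ne k h h' hab hac hq13,
    ← mul_assoc (klrSR k r r') (klrPsiR k r' i), klrSR_mul_klrPsiR_next_of_eq_ne k h h' hab hac,
    ← mul_assoc (klrSR k r r') (klrPsiR k r i), klrSR_mul_klrPsiR_of_eq' k h hab,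
    ← mul_assoc (klrSR k r r') (klrIdemR k i), A1,
    ← mul_assoc (klrSR k r r') (klrPsiR k r' i), klrSR_mul_klrPsiR_next_of_eq_ne k h h' hab hac,
    ← mul_assoc (klrSR k r r') (klrIdemR k i), A1]

/-- **Normal form of `s_{r+1}s_rs_{r+1} ē(𝐢)` for `i_r = i_{r+1} ≠ i_{r+2}`.** [folklore] -/
theorem klrSR_triple_rhs_of_eq_ne {d2 : KLRAlgebra k p n}
    (hq2 : klrQR k r' r'' i * klrPsiR k r i = klrPsiR k r i * klrQR k r r'' i + klrIdemR k i * d2) :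
    klrSR k r' r'' * (klrSR k r r' * (klrSR k r' r'' * klrIdemR k i)) =
      (klrPsiR k r (i ∘ swap r' r'') * klrPsiR k r' i * klrPsiR k r i * klrQR k r r' i -
        klrPsiR k r (i ∘ swap r' r'') * klrPsiR k r' i) * (klrQR k r r'' i * klrQR k r' r'' i) -
      (klrIdemR k i * klrQQ k r' r'' i * klrQR k r'' r' i - klrPsiR k r' i * klrPR k r'' r' i) *
        (klrPR k r r'' i * klrQR k r' r'' i) -
      (klrPsiR k r' i * klrPsiR k r i * klrQR k r r'' i + klrPsiR k r' i * d2 - klrPsiR k r i * klrPR k r r'' i +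
        klrIdemR k i * (klrPR k r' r'' i * klrPR k r r'' i)) * (klrQR k r r' i * klrPR k r' r'' i) +
      (klrPsiR k r' i * klrQR k r' r'' i - klrIdemR k i * klrPR k r' r'' i) * klrPR k r' r'' i := by
  have cep : klrIdemR k i * klrPR k r' r'' i = klrPR k r' r'' i * klrIdemR k i :=
    klrIdemR_mul_of_mem_klrYAlg k (klrPR_mem_klrYAlg k r' r'' i) i
  have A1 : klrSR k r r' * klrIdemR k i = klrPsiR k r i * klrQR k r r' i - klrIdemR k i := by
    rw [klrSR_mul_klrIdemR', klrPR_of_eq k hab, mul_one]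
  rw [klrSR_mul_klrIdemR']
  have B2 : klrSR k r r' * (klrPsiR k r' i * klrQR k r' r'' i - klrIdemR k i * klrPR k r' r'' i) =
      klrPsiR k r (i ∘ swap r' r'') * klrPsiR k r' i * (klrQR k r r'' i * klrQR k r' r'' i) -
        klrPsiR k r' i * (klrPR k r r'' i * klrQR k r' r'' i) -
        klrPsiR k r i * (klrQR k r r' i * klrPR k r' r'' i) + klrIdemR k i * klrPR k r' r'' i := by
    rw [mul_sub, ← mul_assoc, klrSR_mul_klrPsiR_next_of_eq_ne k h h' hab hac, ← mul_assoc, A1]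
    simp only [sub_mul, mul_assoc]
    abel
  rw [B2, mul_add, mul_sub, mul_sub, ← mul_assoc, klrSR_next_mul_klrPsiR_one_two_of_eq_ne k h h' hab hac,
    ← mul_assoc (klrSR k r' r'') (klrPsiR k r' i), klrSR_next_mul_klrPsiR_next_of_ne k h' hab hac,
    ← mul_assoc (klrSR k r' r'') (klrPsiR k r i), klrSR_next_mul_klrPsiR_of_eq_ne k h h' hab hac hq2,
    ← mul_assoc (klrSR k r' r'') (klrIdemR k i), klrSR_mul_klrIdemR']

open scoped IsMulCommutative in
omit h h' in
/-- **`p_{r+1,r+2} - p_{r,r+2} = p_{r+1,r+2} p_{r,r+2} (ȳ_r - ȳ_{r+1})`** (`i_r = i_{r+1} ≠ i_{r+2}`):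
the two units differ by `ȳ_r - ȳ_{r+1}`. [folklore] -/
theorem klrPR_next_sub_klrPR_far_of_eq_ne :
    klrPR k r' r'' i - klrPR k r r'' i = klrPR k r' r'' i * klrPR k r r'' i * (klrYR k r - klrYR k r') := by
  have hbc : i r' ≠ i r'' := fun e => hac (hab.trans e)
  have hc : resK k (i r') - resK k (i r'') ≠ 0 := resK_sub_ne_zero k hbc
  have hu2 := isUnit_klrDiffUnitR k (p := p) r' r'' hc
  have hu3 := isUnit_klrDiffUnitR k (p := p) r r'' hc
  have e1 : klrPR k r' r'' i = Ring.inverse (klrDiffUnitR k r' r'' (resK k (i r') - resK k (i r''))) := if_neg hbc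
  have e2 : klrPR k r r'' i = Ring.inverse (klrDiffUnitR k r r'' (resK k (i r') - resK k (i r''))) := by
    rw [← hab]; exact if_neg hac
  have hE : klrDiffUnitR k (p := p) r r'' (resK k (i r') - resK k (i r'')) =
      klrDiffUnitR k r' r'' (resK k (i r') - resK k (i r'')) + (klrYR k r - klrYR k r') := by
    simp only [klrDiffUnitR]; abel
  have R2 := Ring.inverse_mul_cancel _ hu2
  have R3 := Ring.inverse_mul_cancel _ hu3
  rw [← e1] at R2
  rw [← e2] at R3
  obtain ⟨p2, hp2⟩ : ∃ x : klrYAlg k (p := p) (n := n), (x : KLRAlgebra k p n) = klrPR k r' r'' i :=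
    ⟨⟨_, klrPR_mem_klrYAlg k _ _ _⟩, rfl⟩
  obtain ⟨p3, hp3⟩ : ∃ x : klrYAlg k (p := p) (n := n), (x : KLRAlgebra k p n) = klrPR k r r'' i :=
    ⟨⟨_, klrPR_mem_klrYAlg k _ _ _⟩, rfl⟩
  obtain ⟨u2, hu2'⟩ : ∃ x : klrYAlg k (p := p) (n := n), (x : KLRAlgebra k p n) =
      klrDiffUnitR k r' r'' (resK k (i r') - resK k (i r'')) := ⟨⟨_, klrDiffUnitR_mem_klrYAlg k _ _ _⟩, rfl⟩
  obtain ⟨u3, hu3'⟩ : ∃ x : klrYAlg k (p := p) (n := n), (x : KLRAlgebra k p n) =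
      klrDiffUnitR k r r'' (resK k (i r') - resK k (i r'')) := ⟨⟨_, klrDiffUnitR_mem_klrYAlg k _ _ _⟩, rfl⟩
  obtain ⟨Y1, hY1⟩ : ∃ x : klrYAlg k (p := p) (n := n), (x : KLRAlgebra k p n) = klrYR k r :=
    ⟨⟨_, klrYR_mem_klrYAlg k _⟩, rfl⟩
  obtain ⟨Y2, hY2⟩ : ∃ x : klrYAlg k (p := p) (n := n), (x : KLRAlgebra k p n) = klrYR k r' :=
    ⟨⟨_, klrYR_mem_klrYAlg k _⟩, rfl⟩
  rw [← hp2, ← hu2'] at R2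
  rw [← hp3, ← hu3'] at R3
  rw [← hu2', ← hu3', ← hY1, ← hY2] at hE
  have R2' : p2 * u2 = 1 := by exact_mod_cast R2
  have R3' : p3 * u3 = 1 := by exact_mod_cast R3
  have hE' : u3 = u2 + (Y1 - Y2) := by exact_mod_cast hE
  rw [← hp2, ← hp3, ← hY1, ← hY2]
  exact_mod_cast (show p2 - p3 = p2 * p3 * (Y1 - Y2) by
    linear_combination (p2 * p3) * hE' + p3 * R2' + (-p2) * R3')

open scoped IsMulCommutative in
/-- **BK Thm 3.3, braid relation on `ē(𝐢)` for `i_r = i_{r+1} ≠ i_{r+2}`, given the `∂`-data `d₂, d₁₃` of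
`q_{r+1,r+2}`, `q_{r,r+2}` through `P_r(𝐢)`** with `d₂ + d₁₃ = 0` and `(ȳ_r - ȳ_{r+1}) d₂ = q_{r,r+2} - q_{r+1,r+2}`. [folklore] -/
theorem klrSR_braid_mul_klrIdemR_of_eq_ne_aux {d2 d13 : KLRAlgebra k p n}
    (hd2m : d2 ∈ klrYAlg k (p := p) (n := n)) (hd13m : d13 ∈ klrYAlg k (p := p) (n := n))
    (hq2 : klrQR k r' r'' i * klrPsiR k r i = klrPsiR k r i * klrQR k r r'' i + klrIdemR k i * d2)
    (hq13 : klrQR k r r'' i * klrPsiR k r i = klrPsiR k r i * klrQR k r' r'' i + klrIdemR k i * d13)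
    (hd : d2 + d13 = 0) (hD : (klrYR k r - klrYR k r') * d2 = klrQR k r r'' i - klrQR k r' r'' i) :
    klrSR k r r' * (klrSR k r' r'' * (klrSR k r r' * klrIdemR k i)) =
      klrSR k r' r'' * (klrSR k r r' * (klrSR k r' r'' * klrIdemR k i)) := by
  have hbc : i r' ≠ i r'' := fun e => hac (hab.trans e)
  rw [klrSR_triple_lhs_of_eq_ne k h h' hab hac hq2 hq13, klrSR_triple_rhs_of_eq_ne k h h' hab hac hq2,
    klrQR_rev_eq_klrQsR k hbc]
  have hI2 := klrPR_next_sub_klrPR_far_of_eq_ne k hab hac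
  have hq1 : klrQR k r r' i = 1 + (klrYR k r' - klrYR k r) := by rw [klrQR, if_pos hab]
  have hQ := klrQuadratic_scalar' k (r := r') (r' := r'') hbc
  have h32 := klrPR_rev k (r := r') (r' := r'') hbc
  obtain ⟨p2, hp2⟩ : ∃ x : klrYAlg k (p := p) (n := n), (x : KLRAlgebra k p n) = klrPR k r' r'' i :=
    ⟨⟨_, klrPR_mem_klrYAlg k _ _ _⟩, rfl⟩
  obtain ⟨p3, hp3⟩ : ∃ x : klrYAlg k (p := p) (n := n), (x : KLRAlgebra k p n) = klrPR k r r'' i :=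
    ⟨⟨_, klrPR_mem_klrYAlg k _ _ _⟩, rfl⟩
  obtain ⟨p32, hp32⟩ : ∃ x : klrYAlg k (p := p) (n := n), (x : KLRAlgebra k p n) = klrPR k r'' r' i :=
    ⟨⟨_, klrPR_mem_klrYAlg k _ _ _⟩, rfl⟩
  obtain ⟨q1, hq1'⟩ : ∃ x : klrYAlg k (p := p) (n := n), (x : KLRAlgebra k p n) = klrQR k r r' i :=
    ⟨⟨_, klrQR_mem_klrYAlg k _ _ _⟩, rfl⟩
  obtain ⟨q2, hq2'⟩ : ∃ x : klrYAlg k (p := p) (n := n), (x : KLRAlgebra k p n) = klrQR k r' r'' i :=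
    ⟨⟨_, klrQR_mem_klrYAlg k _ _ _⟩, rfl⟩
  obtain ⟨q3, hq3⟩ : ∃ x : klrYAlg k (p := p) (n := n), (x : KLRAlgebra k p n) = klrQR k r r'' i :=
    ⟨⟨_, klrQR_mem_klrYAlg k _ _ _⟩, rfl⟩
  obtain ⟨Q2, hQ2⟩ : ∃ x : klrYAlg k (p := p) (n := n), (x : KLRAlgebra k p n) = klrQQ k r' r'' i :=
    ⟨⟨_, klrQQ_mem_klrYAlg k _ _ _⟩, rfl⟩
  obtain ⟨s2, hs2⟩ : ∃ x : klrYAlg k (p := p) (n := n), (x : KLRAlgebra k p n) = klrQsR k r' r'' i :=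
    ⟨⟨_, klrQsR_mem_klrYAlg k _ _ _⟩, rfl⟩
  obtain ⟨Y1, hY1⟩ : ∃ x : klrYAlg k (p := p) (n := n), (x : KLRAlgebra k p n) = klrYR k r :=
    ⟨⟨_, klrYR_mem_klrYAlg k _⟩, rfl⟩
  obtain ⟨Y2, hY2⟩ : ∃ x : klrYAlg k (p := p) (n := n), (x : KLRAlgebra k p n) = klrYR k r' :=
    ⟨⟨_, klrYR_mem_klrYAlg k _⟩, rfl⟩
  obtain ⟨e2, he2⟩ : ∃ x : klrYAlg k (p := p) (n := n), (x : KLRAlgebra k p n) = d2 := ⟨⟨_, hd2m⟩, rfl⟩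
  obtain ⟨e13, he13⟩ : ∃ x : klrYAlg k (p := p) (n := n), (x : KLRAlgebra k p n) = d13 := ⟨⟨_, hd13m⟩, rfl⟩
  rw [← hp2, ← hp3, ← hY1, ← hY2] at hI2
  rw [← hq1', ← hY1, ← hY2] at hq1
  rw [← hQ2, ← hs2, ← hq2', ← hp2] at hQ
  rw [← hp2, ← hp32] at h32
  rw [← he2, ← he13] at hd
  rw [← hY1, ← hY2, ← he2, ← hq3, ← hq2'] at hD
  have hI2' : p2 - p3 = p2 * p3 * (Y1 - Y2) := by exact_mod_cast hI2
  have hq1'' : q1 = 1 + (Y2 - Y1) := by exact_mod_cast hq1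
  have hQ' : Q2 * s2 * q2 + p2 * p2 = 1 := by exact_mod_cast hQ
  have h32' : p32 = -p2 := by exact_mod_cast h32
  have hd' : e2 + e13 = 0 := by exact_mod_cast hd
  have hD' : (Y1 - Y2) * e2 = q3 - q2 := by exact_mod_cast hD
  set W121 := klrPsiR k r (i ∘ swap r' r'') * klrPsiR k r' i * klrPsiR k r i
  set W12 := klrPsiR k r (i ∘ swap r' r'') * klrPsiR k r' i
  set W21 := klrPsiR k r' i * klrPsiR k r i
  set P1 := klrPsiR k r i
  set P2 := klrPsiR k r' i
  set E := klrIdemR k i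
  rw [← hp2, ← hp3, ← hp32, ← hq1', ← hq2', ← hq3, ← hQ2, ← hs2, ← he2, ← he13]
  have key : ∀ (a121 b121 a12 b12 a21 b21 a1 b1 a2 b2 a0 b0 : klrYAlg k (p := p) (n := n)),
      a121 = b121 → a12 = b12 → a21 = b21 → a1 = b1 → a2 = b2 → a0 = b0 →
      W121 * a121 + W12 * a12 + W21 * a21 + P1 * a1 + P2 * a2 + E * a0 =
        W121 * b121 + W12 * b12 + W21 * b21 + P1 * b1 + P2 * b2 + E * b0 := by
    intros; subst_vars; rfl
  have eL : (W121 * (q2 : KLRAlgebra k p n) + W12 * (e13 : KLRAlgebra k p n) - W21 * (p2 : KLRAlgebra k p n) -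
        P2 * ((p3 : KLRAlgebra k p n) * p2)) * ((q3 : KLRAlgebra k p n) * q1) +
      (W12 * (q3 : KLRAlgebra k p n) - P2 * (p3 : KLRAlgebra k p n)) * ((e2 : KLRAlgebra k p n) * q1) -
      P1 * ((p3 : KLRAlgebra k p n) * q1) +
      (P1 * (q1 : KLRAlgebra k p n) - E) * ((p2 : KLRAlgebra k p n) * p3 * q1) -
      (W12 * (q3 : KLRAlgebra k p n) - P2 * (p3 : KLRAlgebra k p n)) * q2 +
      (P1 * (q1 : KLRAlgebra k p n) - E) * p2 =
      W121 * ((q2 * (q3 * q1) : klrYAlg k (p := p) (n := n)) : KLRAlgebra k p n) +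
        W12 * ((e13 * (q3 * q1) + q3 * (e2 * q1) - q3 * q2 : klrYAlg k (p := p) (n := n)) : KLRAlgebra k p n) +
        W21 * ((0 - p2 * (q3 * q1) : klrYAlg k (p := p) (n := n)) : KLRAlgebra k p n) +
        P1 * ((0 - p3 * q1 + q1 * (p2 * p3 * q1) + q1 * p2 : klrYAlg k (p := p) (n := n)) : KLRAlgebra k p n) +
        P2 * ((0 - p3 * p2 * (q3 * q1) - p3 * (e2 * q1) + p3 * q2 : klrYAlg k (p := p) (n := n)) :
          KLRAlgebra k p n) +
        E * ((0 - p2 * p3 * q1 - p2 : klrYAlg k (p := p) (n := n)) : KLRAlgebra k p n) := by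
    push_cast
    simp only [sub_mul, add_mul, mul_assoc, mul_add, mul_sub, mul_zero]
    abel
  have eR : (W121 * (q1 : KLRAlgebra k p n) - W12) * ((q3 : KLRAlgebra k p n) * q2) -
      (E * (Q2 : KLRAlgebra k p n) * s2 - P2 * (p32 : KLRAlgebra k p n)) * ((p3 : KLRAlgebra k p n) * q2) -
      (W21 * (q3 : KLRAlgebra k p n) + P2 * (e2 : KLRAlgebra k p n) - P1 * (p3 : KLRAlgebra k p n) +
        E * ((p2 : KLRAlgebra k p n) * p3)) * ((q1 : KLRAlgebra k p n) * p2) +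
      (P2 * (q2 : KLRAlgebra k p n) - E * (p2 : KLRAlgebra k p n)) * p2 =
      W121 * ((q1 * (q3 * q2) : klrYAlg k (p := p) (n := n)) : KLRAlgebra k p n) +
        W12 * ((0 - q3 * q2 : klrYAlg k (p := p) (n := n)) : KLRAlgebra k p n) +
        W21 * ((0 - q3 * (q1 * p2) : klrYAlg k (p := p) (n := n)) : KLRAlgebra k p n) +
        P1 * ((p3 * (q1 * p2) : klrYAlg k (p := p) (n := n)) : KLRAlgebra k p n) +
        P2 * ((p32 * (p3 * q2) - e2 * (q1 * p2) + q2 * p2 : klrYAlg k (p := p) (n := n)) : KLRAlgebra k p n) +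
        E * ((0 - Q2 * s2 * (p3 * q2) - p2 * p3 * (q1 * p2) - p2 * p2 : klrYAlg k (p := p) (n := n)) :
          KLRAlgebra k p n) := by
    push_cast
    simp only [sub_mul, add_mul, mul_assoc, mul_add, mul_sub, mul_zero]
    abel
  rw [eL, eR]
  apply key
  · ring
  · linear_combination (q3 * q1) * hd'
  · ring
  · linear_combination q1 * hI2' + (q1 * p2 * p3) * hq1''
  · rw [h32']; linear_combination (q1 * p2 * p3) * hD' + (e2 * q1) * hI2' + (-q2) * hI2' + (-(q2 * p2 * p3)) * hq1''
  · linear_combination p3 * hQ' + (p2 - 1) * hI2' + (p2 * p3 * (p2 - 1)) * hq1''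

omit h' hac in
omit [CharP k p] in
/-- `klrDelta` at `t = r` in subtraction form. [folklore] -/
theorem klrDelta_left' : klrDelta k r r' i r = 0 - klrIdemR k i := by
  rw [klrDelta_left k h hab]; abel

omit [Fact p.Prime] [CharP k p] h h' hab hac in
/-- Ring identity reshaping the `∂`-term of `q = p² - p`. [folklore] -/
theorem shape_fw_aux {A : Type*} [Ring A] (E a q q' : A) (hc : q * E = E * q) :
    -(E * a) * q' + q * -(E * a) - -(E * a) = E * (a - a * q' - q * a) := by
  rw [neg_mul, mul_neg, sub_neg_eq_add, ← mul_assoc, hc]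
  noncomm_ring

omit [Fact p.Prime] [CharP k p] h h' hab hac in
/-- Ring identity reshaping the `∂`-term of `q = 1 - p`. [folklore] -/
theorem shape_ne_aux {A : Type*} [Ring A] (E a : A) : 0 - -(E * a) = E * a := by
  rw [sub_neg_eq_add, zero_add]

open scoped IsMulCommutative in
/-- **BK Thm 3.3, braid relation on `ē(𝐢)`, case `i_r = i_{r+1} ≠ i_{r+2}`** (all four quiver
configurations of the pair `(i_{r+1}, i_{r+2})`). [folklore] -/
theorem klrSR_braid_mul_klrIdemR_of_eq_ne :
    klrSR k r r' * (klrSR k r' r'' * (klrSR k r r' * klrIdemR k i)) =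
      klrSR k r' r'' * (klrSR k r r' * (klrSR k r' r'' * klrIdemR k i)) := by
  have h1 : r'' ≠ r := by intro e; rw [Fin.ext_iff] at e; omega
  have h2 : r'' ≠ r' := by intro e; rw [Fin.ext_iff] at e; omega
  have hbc : i r' ≠ i r'' := fun e => hac (hab.trans e)
  have hS1 : i ∘ swap r r' = i := comp_swap_eq_self_of_eq hab
  have hI2 := klrPR_next_sub_klrPR_far_of_eq_ne k hab hac
  -- commuting `ē(𝐢)` past `p`'s
  have cep2 : klrIdemR k i * klrPR k r' r'' i = klrPR k r' r'' i * klrIdemR k i :=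
    klrIdemR_mul_of_mem_klrYAlg k (klrPR_mem_klrYAlg k _ _ _) i
  have cep3 : klrIdemR k i * klrPR k r r'' i = klrPR k r r'' i * klrIdemR k i :=
    klrIdemR_mul_of_mem_klrYAlg k (klrPR_mem_klrYAlg k _ _ _) i
  -- the `∂`-terms of the two `p`'s through `P_r(𝐢)`
  have hA : klrPR k r' r'' i * (klrDelta k r r' i r' - klrDelta k r r' i r'') * klrPR k r r'' i =
      klrIdemR k i * (klrPR k r' r'' i * klrPR k r r'' i) := by
    rw [klrDelta_right k hab, klrDelta_of_ne_of_ne k h1 h2, sub_zero, ← cep2, mul_assoc]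
  have hA' : klrPR k r r'' i * (klrDelta k r r' i r - klrDelta k r r' i r'') * klrPR k r' r'' i =
      klrIdemR k i * (0 - klrPR k r r'' i * klrPR k r' r'' i) := by
    rw [klrDelta_left' k h hab, klrDelta_of_ne_of_ne k h1 h2, sub_zero, mul_sub, mul_zero, sub_mul, zero_mul,
      ← cep3, mul_assoc, mul_sub, mul_zero]
  -- casts for the scalar side conditions
  obtain ⟨p2, hp2⟩ : ∃ x : klrYAlg k (p := p) (n := n), (x : KLRAlgebra k p n) = klrPR k r' r'' i :=
    ⟨⟨_, klrPR_mem_klrYAlg k _ _ _⟩, rfl⟩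
  obtain ⟨p3, hp3⟩ : ∃ x : klrYAlg k (p := p) (n := n), (x : KLRAlgebra k p n) = klrPR k r r'' i :=
    ⟨⟨_, klrPR_mem_klrYAlg k _ _ _⟩, rfl⟩
  obtain ⟨Y1, hY1⟩ : ∃ x : klrYAlg k (p := p) (n := n), (x : KLRAlgebra k p n) = klrYR k r :=
    ⟨⟨_, klrYR_mem_klrYAlg k _⟩, rfl⟩
  obtain ⟨Y2, hY2⟩ : ∃ x : klrYAlg k (p := p) (n := n), (x : KLRAlgebra k p n) = klrYR k r' :=
    ⟨⟨_, klrYR_mem_klrYAlg k _⟩, rfl⟩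
  have hI2' : p2 - p3 = p2 * p3 * (Y1 - Y2) := by
    rw [← hp2, ← hp3, ← hY1, ← hY2] at hI2; exact_mod_cast hI2
  have hm23 : klrPR k r' r'' i * klrPR k r r'' i ∈ klrYAlg k (p := p) (n := n) :=
    mul_mem (klrPR_mem_klrYAlg k _ _ _) (klrPR_mem_klrYAlg k _ _ _)
  have hm32' : (0 : KLRAlgebra k p n) - klrPR k r r'' i * klrPR k r' r'' i ∈ klrYAlg k (p := p) (n := n) :=
    sub_mem (zero_mem _) (mul_mem (klrPR_mem_klrYAlg k _ _ _) (klrPR_mem_klrYAlg k _ _ _))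
  by_cases hfw : i r'' = i r' + 1 <;> by_cases hbw : i r' = i r'' + 1
  · -- `i_{r+1} ⇄ i_{r+2}`: `q = -p`
    have hfw' : i r'' = i r + 1 := by rw [hab]; exact hfw
    have hbw' : i r = i r'' + 1 := by rw [hab]; exact hbw
    refine klrSR_braid_mul_klrIdemR_of_eq_ne_aux k h h' hab hac hm23 hm32' ?_ ?_ ?_ ?_
    · rw [klrQR_mul_klrPsiR_rule_of_fw_bw k h i hbc hfw hbw]
      simp only [swap_apply_right, swap_apply_of_ne_of_ne h1 h2, hS1]
      rw [hA]
    · rw [klrQR_mul_klrPsiR_rule_of_fw_bw k h i hac hfw' hbw']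
      simp only [swap_apply_left, swap_apply_of_ne_of_ne h1 h2, hS1]
      rw [hA']
    · rw [← hp2, ← hp3]; exact_mod_cast (show p2 * p3 + (0 - p3 * p2) = 0 by ring)
    · have e2 : klrQR k r' r'' i = -klrPR k r' r'' i := by rw [klrQR, if_neg hbc, if_pos hfw, if_pos hbw]
      have e3 : klrQR k r r'' i = -klrPR k r r'' i := by rw [klrQR, if_neg hac, if_pos hfw', if_pos hbw']
      rw [e2, e3, ← hp2, ← hp3, ← hY1, ← hY2]
      exact_mod_cast (show (Y1 - Y2) * (p2 * p3) = -p3 - -p2 by linear_combination (-1 : klrYAlg k (p := p) (n := n)) * hI2')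
  · -- `i_{r+1} → i_{r+2}` only: `q = p² - p`
    have hfw' : i r'' = i r + 1 := by rw [hab]; exact hfw
    have hbw' : ¬ i r = i r'' + 1 := by rw [hab]; exact hbw
    have hm2 : klrPR k r' r'' i * klrPR k r r'' i - klrPR k r' r'' i * klrPR k r r'' i * klrPR k r r'' i -
        klrPR k r' r'' i * (klrPR k r' r'' i * klrPR k r r'' i) ∈ klrYAlg k (p := p) (n := n) :=
      sub_mem (sub_mem hm23 (mul_mem hm23 (klrPR_mem_klrYAlg k _ _ _))) (mul_mem (klrPR_mem_klrYAlg k _ _ _) hm23)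
    have hm3 : (0 - klrPR k r r'' i * klrPR k r' r'' i) - (0 - klrPR k r r'' i * klrPR k r' r'' i) * klrPR k r' r'' i -
        klrPR k r r'' i * (0 - klrPR k r r'' i * klrPR k r' r'' i) ∈ klrYAlg k (p := p) (n := n) :=
      sub_mem (sub_mem hm32' (mul_mem hm32' (klrPR_mem_klrYAlg k _ _ _))) (mul_mem (klrPR_mem_klrYAlg k _ _ _) hm32')
    refine klrSR_braid_mul_klrIdemR_of_eq_ne_aux k h h' hab hac hm2 hm3 ?_ ?_ ?_ ?_
    · rw [klrQR_mul_klrPsiR_rule_of_fw k h i hbc hfw hbw]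
      simp only [swap_apply_right, swap_apply_of_ne_of_ne h1 h2, hS1]
      rw [hA, shape_fw_aux (klrIdemR k i) (klrPR k r' r'' i * klrPR k r r'' i) (klrPR k r' r'' i) (klrPR k r r'' i)
        cep2.symm]
    · rw [klrQR_mul_klrPsiR_rule_of_fw k h i hac hfw' hbw']
      simp only [swap_apply_left, swap_apply_of_ne_of_ne h1 h2, hS1]
      rw [hA', shape_fw_aux (klrIdemR k i) (0 - klrPR k r r'' i * klrPR k r' r'' i) (klrPR k r r'' i)
        (klrPR k r' r'' i) cep3.symm]
    · rw [← hp2, ← hp3]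
      exact_mod_cast (show p2 * p3 - p2 * p3 * p3 - p2 * (p2 * p3) +
        ((0 - p3 * p2) - (0 - p3 * p2) * p2 - p3 * (0 - p3 * p2)) = 0 by ring)
    · have e2 : klrQR k r' r'' i = klrPR k r' r'' i * klrPR k r' r'' i - klrPR k r' r'' i := by
        rw [klrQR, if_neg hbc, if_pos hfw, if_neg hbw]
      have e3 : klrQR k r r'' i = klrPR k r r'' i * klrPR k r r'' i - klrPR k r r'' i := by
        rw [klrQR, if_neg hac, if_pos hfw', if_neg hbw']
      rw [e2, e3, ← hp2, ← hp3, ← hY1, ← hY2]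
      exact_mod_cast (show (Y1 - Y2) * (p2 * p3 - p2 * p3 * p3 - p2 * (p2 * p3)) =
        p3 * p3 - p3 - (p2 * p2 - p2) by linear_combination (p3 + p2 - 1) * hI2')
  · -- `i_{r+1} ← i_{r+2}` only: `q = 1`
    have hfw' : ¬ i r'' = i r + 1 := by rw [hab]; exact hfw
    have hbw' : i r = i r'' + 1 := by rw [hab]; exact hbw
    refine klrSR_braid_mul_klrIdemR_of_eq_ne_aux k h h' hab hac (zero_mem _) (zero_mem _) ?_ ?_ ?_ ?_
    · rw [klrQR_mul_klrPsiR_rule_of_bw k (r := r) (r' := r') i hbc hfw hbw, mul_zero]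
      simp only [swap_apply_right, swap_apply_of_ne_of_ne h1 h2, hS1]
    · rw [klrQR_mul_klrPsiR_rule_of_bw k (r := r) (r' := r') i hac hfw' hbw', mul_zero]
      simp only [swap_apply_left, swap_apply_of_ne_of_ne h1 h2, hS1]
    · rw [add_zero]
    · have e2 : klrQR k r' r'' i = 1 := by rw [klrQR, if_neg hbc, if_neg hfw, if_pos hbw]
      have e3 : klrQR k r r'' i = 1 := by rw [klrQR, if_neg hac, if_neg hfw', if_pos hbw']
      rw [e2, e3, mul_zero, sub_self]
  · -- unrelated: `q = 1 - p`
    have hfw' : ¬ i r'' = i r + 1 := by rw [hab]; exact hfw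
    have hbw' : ¬ i r = i r'' + 1 := by rw [hab]; exact hbw
    refine klrSR_braid_mul_klrIdemR_of_eq_ne_aux k h h' hab hac hm23 hm32' ?_ ?_ ?_ ?_
    · rw [klrQR_mul_klrPsiR_rule_of_ne k h i hbc hfw hbw]
      simp only [swap_apply_right, swap_apply_of_ne_of_ne h1 h2, hS1]
      rw [hA, shape_ne_aux]
    · rw [klrQR_mul_klrPsiR_rule_of_ne k h i hac hfw' hbw']
      simp only [swap_apply_left, swap_apply_of_ne_of_ne h1 h2, hS1]
      rw [hA', shape_ne_aux]
    · rw [← hp2, ← hp3]; exact_mod_cast (show p2 * p3 + (0 - p3 * p2) = 0 by ring)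
    · have e2 : klrQR k r' r'' i = 1 - klrPR k r' r'' i := by rw [klrQR, if_neg hbc, if_neg hfw, if_neg hbw]
      have e3 : klrQR k r r'' i = 1 - klrPR k r r'' i := by rw [klrQR, if_neg hac, if_neg hfw', if_neg hbw']
      rw [e2, e3, ← hp2, ← hp3, ← hY1, ← hY2]
      exact_mod_cast (show (Y1 - Y2) * (p2 * p3) = 1 - p3 - (1 - p2) by linear_combination (-1 : klrYAlg k (p := p) (n := n)) * hI2')

end

end BraidEqNe


/-! ### BK Thm 3.3, braid relation: the case `i_r ≠ i_{r+1} = i_{r+2}` -/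

section BraidNeEq

variable (k : Type*) [Field k] (p n : ℕ) [Fact p.Prime] [CharP k p]

variable {p n}

section
variable {r r' r'' : Fin n} (h : (r' : ℕ) = r + 1) (h' : (r'' : ℕ) = r' + 1) {i : Fin n → ZMod p}
  (hab : i r ≠ i r') (hbc : i r' = i r'')
include h h' hab hbc

omit hab in
omit [CharP k p] in
/-- `(c + ȳ_r - ȳ_{r+1}) P_{r+1}(𝐢) = P_{r+1}(𝐢)(c + ȳ_r - ȳ_{r+2}) + ē(𝐢)` (`i_{r+1} = i_{r+2}`). [folklore] -/
theorem klrDiffUnitR_mul_klrPsiR_next_of_ne_eq (c : k) :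
    klrDiffUnitR k r r' c * klrPsiR k r' i = klrPsiR k r' i * klrDiffUnitR k r r'' c + klrIdemR k i := by
  have h1 : r ≠ r' := by intro e; rw [Fin.ext_iff] at e; omega
  have h2 : r ≠ r'' := by intro e; rw [Fin.ext_iff] at e; omega
  rw [klrDiffUnitR_mul_klrPsiR_rule k h' i r r' c, swap_apply_left, swap_apply_of_ne_of_ne h1 h2,
    klrDelta_left k h' hbc, klrDelta_of_ne_of_ne k h1 h2, sub_neg_eq_add (0 : KLRAlgebra k p n) (klrIdemR k i),
    zero_add]

omit hab in
omit [CharP k p] in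
/-- `(c + ȳ_r - ȳ_{r+2}) P_{r+1}(𝐢) = P_{r+1}(𝐢)(c + ȳ_r - ȳ_{r+1}) - ē(𝐢)` (`i_{r+1} = i_{r+2}`). [folklore] -/
theorem klrDiffUnitR_far_mul_klrPsiR_next_of_ne_eq (c : k) :
    klrDiffUnitR k r r'' c * klrPsiR k r' i = klrPsiR k r' i * klrDiffUnitR k r r' c + (0 - klrIdemR k i) := by
  have h1 : r ≠ r' := by intro e; rw [Fin.ext_iff] at e; omega
  have h2 : r ≠ r'' := by intro e; rw [Fin.ext_iff] at e; omega
  rw [klrDiffUnitR_mul_klrPsiR_rule k h' i r r'' c, swap_apply_right, swap_apply_of_ne_of_ne h1 h2,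
    klrDelta_right k hbc, klrDelta_of_ne_of_ne k h1 h2]

/-- **`p_{r,r+1}(𝐢) P_{r+1}(𝐢) = P_{r+1}(𝐢) p_{r,r+2}(𝐢) - ē(𝐢) p_{r,r+1} p_{r,r+2}`** (`i_r ≠ i_{r+1} = i_{r+2}`). [folklore] -/
theorem klrPR_mul_klrPsiR_next_of_ne_eq :
    klrPR k r r' i * klrPsiR k r' i =
      klrPsiR k r' i * klrPR k r r'' i - klrIdemR k i * (klrPR k r r' i * klrPR k r r'' i) := by
  have hac : i r ≠ i r'' := fun e => hab (e.trans hbc.symm)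
  have hc : resK k (i r) - resK k (i r') ≠ 0 := resK_sub_ne_zero k hab
  have hrule := klrDiffUnitR_mul_klrPsiR_next_of_ne_eq k h h' hbc (resK k (i r) - resK k (i r'))
  have hinv := ringInverse_mul_of_rule hrule (isUnit_klrDiffUnitR k _ _ hc) (isUnit_klrDiffUnitR k _ _ hc)
  have e1 : klrPR k r r' i = Ring.inverse (klrDiffUnitR k r r' (resK k (i r) - resK k (i r'))) := if_neg hab
  have e2 : klrPR k r r'' i = Ring.inverse (klrDiffUnitR k r r'' (resK k (i r) - resK k (i r'))) := by
    rw [hbc]; exact if_neg hac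
  have hmem := ringInverse_mem_klrYAlg k
    (klrDiffUnitR_mem_klrYAlg k (p := p) (n := n) r r' (resK k (i r) - resK k (i r'))) (isUnit_klrDiffUnitR k _ _ hc)
  rw [e1, e2, hinv, ← klrIdemR_mul_of_mem_klrYAlg k hmem i, mul_assoc]

/-- **`p_{r,r+2}(𝐢) P_{r+1}(𝐢) = P_{r+1}(𝐢) p_{r,r+1}(𝐢) + ē(𝐢) p_{r,r+2} p_{r,r+1}`** (`i_r ≠ i_{r+1} = i_{r+2}`). [folklore] -/
theorem klrPR_far_mul_klrPsiR_next_of_ne_eq :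
    klrPR k r r'' i * klrPsiR k r' i =
      klrPsiR k r' i * klrPR k r r' i + klrIdemR k i * (klrPR k r r'' i * klrPR k r r' i) := by
  have hac : i r ≠ i r'' := fun e => hab (e.trans hbc.symm)
  have hc : resK k (i r) - resK k (i r') ≠ 0 := resK_sub_ne_zero k hab
  have hrule := klrDiffUnitR_far_mul_klrPsiR_next_of_ne_eq k h h' hbc (resK k (i r) - resK k (i r'))
  have hinv := ringInverse_mul_of_rule hrule (isUnit_klrDiffUnitR k _ _ hc) (isUnit_klrDiffUnitR k _ _ hc)
  have e1 : klrPR k r r' i = Ring.inverse (klrDiffUnitR k r r' (resK k (i r) - resK k (i r'))) := if_neg hab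
  have e2 : klrPR k r r'' i = Ring.inverse (klrDiffUnitR k r r'' (resK k (i r) - resK k (i r'))) := by
    rw [hbc]; exact if_neg hac
  have hmem := ringInverse_mem_klrYAlg k
    (klrDiffUnitR_mem_klrYAlg k (p := p) (n := n) r r'' (resK k (i r) - resK k (i r'))) (isUnit_klrDiffUnitR k _ _ hc)
  rw [e1, e2, hinv]
  simp only [mul_sub, sub_mul, mul_zero, zero_mul]
  rw [← klrIdemR_mul_of_mem_klrYAlg k hmem i, mul_assoc]
  abel

/-- `s_r P_{r+1}(𝐢)` for `i_r ≠ i_{r+1} = i_{r+2}`, given the `∂`-datum `d₁` of `q_{r,r+1}` through `P_{r+1}`. [folklore] -/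
theorem klrSR_mul_klrPsiR_next_of_ne_eq {d1 : KLRAlgebra k p n}
    (hq1 : klrQR k r r' i * klrPsiR k r' i = klrPsiR k r' i * klrQR k r r'' i + klrIdemR k i * d1) :
    klrSR k r r' * klrPsiR k r' i =
      klrPsiR k r i * klrPsiR k r' i * klrQR k r r'' i + klrPsiR k r i * d1 - klrPsiR k r' i * klrPR k r r'' i +
        klrIdemR k i * (klrPR k r r' i * klrPR k r r'' i) := by
  rw [klrSR_mul_of_top k i (klrIdemR_mul_klrPsiR_of_eq k h' hbc), hq1, klrPR_mul_klrPsiR_next_of_ne_eq k h h' hab hbc,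
    mul_add, ← mul_assoc, ← mul_assoc, klrPsiR_mul_klrIdemR_self]
  abel

omit hbc in
/-- `s_{r+1} P_r(𝐢) = P_{r+1}(s_r𝐢)P_r(𝐢) q_{r,r+2} - P_r p_{r,r+2}` for `i_r ≠ i_{r+1} = i_{r+2}`. [folklore] -/
theorem klrSR_next_mul_klrPsiR_of_ne_eq :
    klrSR k r' r'' * klrPsiR k r i =
      klrPsiR k r' (i ∘ swap r r') * klrPsiR k r i * klrQR k r r'' i - klrPsiR k r i * klrPR k r r'' i :=
  klrSR_next_mul_klrPsiR k h h' hab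

/-- `s_{r+1} (P_rP_{r+1})(𝐢)` for `i_r ≠ i_{r+1} = i_{r+2}`, given the `∂`-datum `d₁₃` of `q_{r,r+2}`. [folklore] -/
theorem klrSR_next_mul_klrPsiR_one_two_of_ne_eq {d13 : KLRAlgebra k p n}
    (hq13 : klrQR k r r'' i * klrPsiR k r' i = klrPsiR k r' i * klrQR k r r' i + klrIdemR k i * d13) :
    klrSR k r' r'' * (klrPsiR k r i * klrPsiR k r' i) =
      klrPsiR k r' (i ∘ swap r r') * klrPsiR k r i * klrPsiR k r' i * klrQR k r r' i +
        klrPsiR k r' (i ∘ swap r r') * klrPsiR k r i * d13 -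
        klrPsiR k r i * klrPsiR k r' i * klrPR k r r' i -
        klrPsiR k r i * (klrPR k r r'' i * klrPR k r r' i) := by
  have t1 : klrPsiR k r' (i ∘ swap r r') * klrPsiR k r i * klrQR k r r'' i * klrPsiR k r' i =
      klrPsiR k r' (i ∘ swap r r') * klrPsiR k r i * (klrPsiR k r' i * klrQR k r r' i + klrIdemR k i * d13) := by
    rw [mul_assoc, hq13]
  have t2 : klrPsiR k r i * klrPR k r r'' i * klrPsiR k r' i =
      klrPsiR k r i * (klrPsiR k r' i * klrPR k r r' i + klrIdemR k i * (klrPR k r r'' i * klrPR k r r' i)) := by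
    rw [mul_assoc, klrPR_far_mul_klrPsiR_next_of_ne_eq k h h' hab hbc]
  have hPE : klrPsiR k r i * klrIdemR k i = klrPsiR k r i := klrPsiR_mul_klrIdemR_self k r i
  rw [← mul_assoc, klrSR_next_mul_klrPsiR_of_ne_eq k h h' hab, sub_mul, t1, t2]
  simp only [mul_add, ← mul_assoc]
  rw [mul_assoc (klrPsiR k r' _) (klrPsiR k r i) (klrIdemR k i), hPE]
  simp only [mul_assoc]
  abel

omit h hab in
/-- `s_{r+1} P_{r+1}(𝐢) = P_{r+1}(𝐢)` for `i_{r+1} = i_{r+2}`. [folklore] -/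
theorem klrSR_next_mul_klrPsiR_next_of_eq : klrSR k r' r'' * klrPsiR k r' i = klrPsiR k r' i :=
  klrSR_mul_klrPsiR_of_eq' k h' hbc

/-- `s_r (P_{r+1}(s_r𝐢) P_r(𝐢)) = P_rP_{r+1}P_r(𝐢) q_{r+1}(𝐢) - P_{r+1}(s_r𝐢)P_r(𝐢)` for `i_r ≠ i_{r+1} = i_{r+2}`
(top idempotent has equal residues at `r, r+1`; written with the word `P_{r+1}P_rP_{r+1}` via the exact (R7)). [folklore] -/
theorem klrSR_mul_klrPsiR_two_one_of_ne_eq :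
    klrSR k r r' * (klrPsiR k r' (i ∘ swap r r') * klrPsiR k r i) =
      klrPsiR k r' (i ∘ swap r r') * klrPsiR k r i * klrPsiR k r' i * klrQR k r' r'' i -
        klrPsiR k r' (i ∘ swap r r') * klrPsiR k r i := by
  have h1 : r ≠ r' := by intro e; rw [Fin.ext_iff] at e; omega
  have h2 : r ≠ r'' := by intro e; rw [Fin.ext_iff] at e; omega
  have h3 : r'' ≠ r' := by intro e; rw [Fin.ext_iff] at e; omega
  have hac : i r ≠ i r'' := fun e => hab (e.trans hbc.symm)
  set j := i ∘ swap r r' with hj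
  have hjc : j r' ≠ j r'' := by
    simp only [hj, Function.comp_apply, swap_apply_right, swap_apply_of_ne_of_ne h2.symm h3]; exact hac
  have hm : (j ∘ swap r' r'') r = (j ∘ swap r' r'') r' := by
    simp only [hj, Function.comp_apply, swap_apply_left, swap_apply_of_ne_of_ne h1 h2,
      swap_apply_of_ne_of_ne h2.symm h3]
    exact hbc
  have htop : klrIdemR k (j ∘ swap r' r'') * (klrPsiR k r' j * klrPsiR k r i) = klrPsiR k r' j * klrPsiR k r i := by
    rw [← mul_assoc, klrIdemR_swap_mul_klrPsiR k h']
  rw [klrSR_mul_of_top k _ htop, klrPR_of_eq k hm, one_mul, ← mul_assoc (klrQR k r r' _),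
    klrQR_mul_klrPsiR_of_ne k h' hjc, mul_assoc, klrQR_mul_klrPsiR_of_ne k h hab]
  simp only [swap_apply_left, swap_apply_of_ne_of_ne h1 h2, comp_swap_comp_swap, hj,
    swap_apply_of_ne_of_ne h2.symm h3]
  -- (R7) without correction
  have hbr := klrPsiR_braid k h h' i
  rw [comp_swap_eq_self_of_eq hbc, if_neg (fun hh => hab (hh.1.trans hbc.symm)), zero_mul, add_zero] at hbr
  simp only [← mul_assoc]
  rw [hbr]

/-- **Normal form of `s_rs_{r+1}s_r ē(𝐢)` for `i_r ≠ i_{r+1} = i_{r+2}`.** [folklore] -/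
theorem klrSR_triple_lhs_of_ne_eq {d1 : KLRAlgebra k p n}
    (hq1 : klrQR k r r' i * klrPsiR k r' i = klrPsiR k r' i * klrQR k r r'' i + klrIdemR k i * d1) :
    klrSR k r r' * (klrSR k r' r'' * (klrSR k r r' * klrIdemR k i)) =
      (klrPsiR k r' (i ∘ swap r r') * klrPsiR k r i * klrPsiR k r' i * klrQR k r' r'' i -
        klrPsiR k r' (i ∘ swap r r') * klrPsiR k r i) * (klrQR k r r'' i * klrQR k r r' i) -
      (klrIdemR k i * klrQQ k r r' i * klrQsR k r r' i - klrPsiR k r i * klrPR k r' r i) *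
        (klrPR k r r'' i * klrQR k r r' i) -
      (klrPsiR k r i * klrPsiR k r' i * klrQR k r r'' i + klrPsiR k r i * d1 - klrPsiR k r' i * klrPR k r r'' i +
        klrIdemR k i * (klrPR k r r' i * klrPR k r r'' i)) * (klrQR k r' r'' i * klrPR k r r' i) +
      (klrPsiR k r i * klrQR k r r' i - klrIdemR k i * klrPR k r r' i) * klrPR k r r' i := by
  have B1 : klrSR k r' r'' * klrIdemR k i = klrPsiR k r' i * klrQR k r' r'' i - klrIdemR k i := by
    rw [klrSR_mul_klrIdemR', klrPR_of_eq k hbc, mul_one]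
  rw [klrSR_mul_klrIdemR']
  have A2 : klrSR k r' r'' * (klrPsiR k r i * klrQR k r r' i - klrIdemR k i * klrPR k r r' i) =
      klrPsiR k r' (i ∘ swap r r') * klrPsiR k r i * (klrQR k r r'' i * klrQR k r r' i) -
        klrPsiR k r i * (klrPR k r r'' i * klrQR k r r' i) -
        klrPsiR k r' i * (klrQR k r' r'' i * klrPR k r r' i) + klrIdemR k i * klrPR k r r' i := by
    rw [mul_sub, ← mul_assoc, klrSR_next_mul_klrPsiR_of_ne_eq k h h' hab, ← mul_assoc, B1]
    simp only [sub_mul, mul_assoc]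
    abel
  rw [A2, mul_add, mul_sub, mul_sub, ← mul_assoc, klrSR_mul_klrPsiR_two_one_of_ne_eq k h h' hab hbc,
    ← mul_assoc (klrSR k r r') (klrPsiR k r i), klrSR_mul_klrPsiR_same k h hab,
    ← mul_assoc (klrSR k r r') (klrPsiR k r' i), klrSR_mul_klrPsiR_next_of_ne_eq k h h' hab hbc hq1,
    ← mul_assoc (klrSR k r r') (klrIdemR k i), klrSR_mul_klrIdemR']

/-- **Normal form of `s_{r+1}s_rs_{r+1} ē(𝐢)` for `i_r ≠ i_{r+1} = i_{r+2}`.** [folklore] -/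
theorem klrSR_triple_rhs_of_ne_eq {d1 d13 : KLRAlgebra k p n}
    (hq1 : klrQR k r r' i * klrPsiR k r' i = klrPsiR k r' i * klrQR k r r'' i + klrIdemR k i * d1)
    (hq13 : klrQR k r r'' i * klrPsiR k r' i = klrPsiR k r' i * klrQR k r r' i + klrIdemR k i * d13) :
    klrSR k r' r'' * (klrSR k r r' * (klrSR k r' r'' * klrIdemR k i)) =
      (klrPsiR k r' (i ∘ swap r r') * klrPsiR k r i * klrPsiR k r' i * klrQR k r r' i +
        klrPsiR k r' (i ∘ swap r r') * klrPsiR k r i * d13 -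
        klrPsiR k r i * klrPsiR k r' i * klrPR k r r' i -
        klrPsiR k r i * (klrPR k r r'' i * klrPR k r r' i)) * (klrQR k r r'' i * klrQR k r' r'' i) +
      (klrPsiR k r' (i ∘ swap r r') * klrPsiR k r i * klrQR k r r'' i - klrPsiR k r i * klrPR k r r'' i) *
        (d1 * klrQR k r' r'' i) -
      klrPsiR k r' i * (klrPR k r r'' i * klrQR k r' r'' i) +
      (klrPsiR k r' i * klrQR k r' r'' i - klrIdemR k i) * (klrPR k r r' i * klrPR k r r'' i * klrQR k r' r'' i) -
      (klrPsiR k r' (i ∘ swap r r') * klrPsiR k r i * klrQR k r r'' i - klrPsiR k r i * klrPR k r r'' i) *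
        klrQR k r r' i +
      (klrPsiR k r' i * klrQR k r' r'' i - klrIdemR k i) * klrPR k r r' i := by
  have B1 : klrSR k r' r'' * klrIdemR k i = klrPsiR k r' i * klrQR k r' r'' i - klrIdemR k i := by
    rw [klrSR_mul_klrIdemR', klrPR_of_eq k hbc, mul_one]
  have B2 : klrSR k r r' * (klrPsiR k r' i * klrQR k r' r'' i - klrIdemR k i) =
      klrPsiR k r i * klrPsiR k r' i * (klrQR k r r'' i * klrQR k r' r'' i) + klrPsiR k r i * (d1 * klrQR k r' r'' i) -
        klrPsiR k r' i * (klrPR k r r'' i * klrQR k r' r'' i) +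
        klrIdemR k i * (klrPR k r r' i * klrPR k r r'' i * klrQR k r' r'' i) -
        klrPsiR k r i * klrQR k r r' i + klrIdemR k i * klrPR k r r' i := by
    rw [mul_sub, ← mul_assoc, klrSR_mul_klrPsiR_next_of_ne_eq k h h' hab hbc hq1, klrSR_mul_klrIdemR']
    simp only [sub_mul, add_mul, mul_assoc]
    abel
  rw [B1, B2]
  rw [mul_add, mul_sub, mul_add, mul_sub, mul_add, ← mul_assoc, klrSR_next_mul_klrPsiR_one_two_of_ne_eq k h h' hab hbc hq13,
    ← mul_assoc (klrSR k r' r'') (klrPsiR k r i), klrSR_next_mul_klrPsiR_of_ne_eq k h h' hab,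
    ← mul_assoc (klrSR k r' r'') (klrPsiR k r' i), klrSR_next_mul_klrPsiR_next_of_eq k h' hbc,
    ← mul_assoc (klrSR k r' r'') (klrIdemR k i), B1,
    ← mul_assoc (klrSR k r' r'') (klrPsiR k r i), klrSR_next_mul_klrPsiR_of_ne_eq k h h' hab,
    ← mul_assoc (klrSR k r' r'') (klrIdemR k i), B1]

open scoped IsMulCommutative in
omit h h' in
/-- **`p_{r,r+1} - p_{r,r+2} = p_{r,r+1} p_{r,r+2} (ȳ_{r+1} - ȳ_{r+2})`** (`i_r ≠ i_{r+1} = i_{r+2}`). [folklore] -/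
theorem klrPR_sub_klrPR_far_of_ne_eq :
    klrPR k r r' i - klrPR k r r'' i = klrPR k r r' i * klrPR k r r'' i * (klrYR k r' - klrYR k r'') := by
  have hac : i r ≠ i r'' := fun e => hab (e.trans hbc.symm)
  have hc : resK k (i r) - resK k (i r') ≠ 0 := resK_sub_ne_zero k hab
  have hu1 := isUnit_klrDiffUnitR k (p := p) r r' hc
  have hu3 := isUnit_klrDiffUnitR k (p := p) r r'' hc
  have e1 : klrPR k r r' i = Ring.inverse (klrDiffUnitR k r r' (resK k (i r) - resK k (i r'))) := if_neg hab
  have e2 : klrPR k r r'' i = Ring.inverse (klrDiffUnitR k r r'' (resK k (i r) - resK k (i r'))) := by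
    rw [hbc]; exact if_neg hac
  have hE : klrDiffUnitR k (p := p) r r'' (resK k (i r) - resK k (i r')) =
      klrDiffUnitR k r r' (resK k (i r) - resK k (i r')) + (klrYR k r' - klrYR k r'') := by
    simp only [klrDiffUnitR]; abel
  have R1 := Ring.inverse_mul_cancel _ hu1
  have R3 := Ring.inverse_mul_cancel _ hu3
  rw [← e1] at R1
  rw [← e2] at R3
  obtain ⟨p1, hp1⟩ : ∃ x : klrYAlg k (p := p) (n := n), (x : KLRAlgebra k p n) = klrPR k r r' i :=
    ⟨⟨_, klrPR_mem_klrYAlg k _ _ _⟩, rfl⟩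
  obtain ⟨p3, hp3⟩ : ∃ x : klrYAlg k (p := p) (n := n), (x : KLRAlgebra k p n) = klrPR k r r'' i :=
    ⟨⟨_, klrPR_mem_klrYAlg k _ _ _⟩, rfl⟩
  obtain ⟨u1, hu1'⟩ : ∃ x : klrYAlg k (p := p) (n := n), (x : KLRAlgebra k p n) =
      klrDiffUnitR k r r' (resK k (i r) - resK k (i r')) := ⟨⟨_, klrDiffUnitR_mem_klrYAlg k _ _ _⟩, rfl⟩
  obtain ⟨u3, hu3'⟩ : ∃ x : klrYAlg k (p := p) (n := n), (x : KLRAlgebra k p n) =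
      klrDiffUnitR k r r'' (resK k (i r) - resK k (i r')) := ⟨⟨_, klrDiffUnitR_mem_klrYAlg k _ _ _⟩, rfl⟩
  obtain ⟨Y2, hY2⟩ : ∃ x : klrYAlg k (p := p) (n := n), (x : KLRAlgebra k p n) = klrYR k r' :=
    ⟨⟨_, klrYR_mem_klrYAlg k _⟩, rfl⟩
  obtain ⟨Y3, hY3⟩ : ∃ x : klrYAlg k (p := p) (n := n), (x : KLRAlgebra k p n) = klrYR k r'' :=
    ⟨⟨_, klrYR_mem_klrYAlg k _⟩, rfl⟩
  rw [← hp1, ← hu1'] at R1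
  rw [← hp3, ← hu3'] at R3
  rw [← hu1', ← hu3', ← hY2, ← hY3] at hE
  have R1' : p1 * u1 = 1 := by exact_mod_cast R1
  have R3' : p3 * u3 = 1 := by exact_mod_cast R3
  have hE' : u3 = u1 + (Y2 - Y3) := by exact_mod_cast hE
  rw [← hp1, ← hp3, ← hY2, ← hY3]
  exact_mod_cast (show p1 - p3 = p1 * p3 * (Y2 - Y3) by
    linear_combination (p1 * p3) * hE' + p3 * R1' + (-p1) * R3')

open scoped IsMulCommutative in
/-- **BK Thm 3.3, braid relation on `ē(𝐢)` for `i_r ≠ i_{r+1} = i_{r+2}`, given the `∂`-data `d₁, d₁₃` of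
`q_{r,r+1}`, `q_{r,r+2}` through `P_{r+1}(𝐢)`.** [folklore] -/
theorem klrSR_braid_mul_klrIdemR_of_ne_eq_aux {d1 d13 : KLRAlgebra k p n}
    (hd1m : d1 ∈ klrYAlg k (p := p) (n := n)) (hd13m : d13 ∈ klrYAlg k (p := p) (n := n))
    (hq1 : klrQR k r r' i * klrPsiR k r' i = klrPsiR k r' i * klrQR k r r'' i + klrIdemR k i * d1)
    (hq13 : klrQR k r r'' i * klrPsiR k r' i = klrPsiR k r' i * klrQR k r r' i + klrIdemR k i * d13)
    (hd : d1 + d13 = 0) (hD : (klrYR k r' - klrYR k r'') * d1 = klrQR k r r'' i - klrQR k r r' i) :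
    klrSR k r r' * (klrSR k r' r'' * (klrSR k r r' * klrIdemR k i)) =
      klrSR k r' r'' * (klrSR k r r' * (klrSR k r' r'' * klrIdemR k i)) := by
  rw [klrSR_triple_lhs_of_ne_eq k h h' hab hbc hq1, klrSR_triple_rhs_of_ne_eq k h h' hab hbc hq1 hq13]
  have hI3 := klrPR_sub_klrPR_far_of_ne_eq k hab hbc
  have hq2 : klrQR k r' r'' i = 1 + (klrYR k r'' - klrYR k r') := by rw [klrQR, if_pos hbc]
  have hQ := klrQuadratic_scalar' k (r := r) (r' := r') hab
  have h21 := klrPR_rev k (r := r) (r' := r') hab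
  obtain ⟨p1, hp1⟩ : ∃ x : klrYAlg k (p := p) (n := n), (x : KLRAlgebra k p n) = klrPR k r r' i :=
    ⟨⟨_, klrPR_mem_klrYAlg k _ _ _⟩, rfl⟩
  obtain ⟨p3, hp3⟩ : ∃ x : klrYAlg k (p := p) (n := n), (x : KLRAlgebra k p n) = klrPR k r r'' i :=
    ⟨⟨_, klrPR_mem_klrYAlg k _ _ _⟩, rfl⟩
  obtain ⟨p21, hp21⟩ : ∃ x : klrYAlg k (p := p) (n := n), (x : KLRAlgebra k p n) = klrPR k r' r i :=
    ⟨⟨_, klrPR_mem_klrYAlg k _ _ _⟩, rfl⟩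
  obtain ⟨q1, hq1'⟩ : ∃ x : klrYAlg k (p := p) (n := n), (x : KLRAlgebra k p n) = klrQR k r r' i :=
    ⟨⟨_, klrQR_mem_klrYAlg k _ _ _⟩, rfl⟩
  obtain ⟨q2, hq2'⟩ : ∃ x : klrYAlg k (p := p) (n := n), (x : KLRAlgebra k p n) = klrQR k r' r'' i :=
    ⟨⟨_, klrQR_mem_klrYAlg k _ _ _⟩, rfl⟩
  obtain ⟨q3, hq3⟩ : ∃ x : klrYAlg k (p := p) (n := n), (x : KLRAlgebra k p n) = klrQR k r r'' i :=
    ⟨⟨_, klrQR_mem_klrYAlg k _ _ _⟩, rfl⟩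
  obtain ⟨Q1, hQ1⟩ : ∃ x : klrYAlg k (p := p) (n := n), (x : KLRAlgebra k p n) = klrQQ k r r' i :=
    ⟨⟨_, klrQQ_mem_klrYAlg k _ _ _⟩, rfl⟩
  obtain ⟨s1, hs1⟩ : ∃ x : klrYAlg k (p := p) (n := n), (x : KLRAlgebra k p n) = klrQsR k r r' i :=
    ⟨⟨_, klrQsR_mem_klrYAlg k _ _ _⟩, rfl⟩
  obtain ⟨Y2, hY2⟩ : ∃ x : klrYAlg k (p := p) (n := n), (x : KLRAlgebra k p n) = klrYR k r' :=
    ⟨⟨_, klrYR_mem_klrYAlg k _⟩, rfl⟩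
  obtain ⟨Y3, hY3⟩ : ∃ x : klrYAlg k (p := p) (n := n), (x : KLRAlgebra k p n) = klrYR k r'' :=
    ⟨⟨_, klrYR_mem_klrYAlg k _⟩, rfl⟩
  obtain ⟨e1, he1⟩ : ∃ x : klrYAlg k (p := p) (n := n), (x : KLRAlgebra k p n) = d1 := ⟨⟨_, hd1m⟩, rfl⟩
  obtain ⟨e13, he13⟩ : ∃ x : klrYAlg k (p := p) (n := n), (x : KLRAlgebra k p n) = d13 := ⟨⟨_, hd13m⟩, rfl⟩
  rw [← hp1, ← hp3, ← hY2, ← hY3] at hI3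
  rw [← hq2', ← hY2, ← hY3] at hq2
  rw [← hQ1, ← hs1, ← hq1', ← hp1] at hQ
  rw [← hp1, ← hp21] at h21
  rw [← he1, ← he13] at hd
  rw [← hY2, ← hY3, ← he1, ← hq3, ← hq1'] at hD
  have hI3' : p1 - p3 = p1 * p3 * (Y2 - Y3) := by exact_mod_cast hI3
  have hq2'' : q2 = 1 + (Y3 - Y2) := by exact_mod_cast hq2
  have hQ' : Q1 * s1 * q1 + p1 * p1 = 1 := by exact_mod_cast hQ
  have h21' : p21 = -p1 := by exact_mod_cast h21
  have hd' : e1 + e13 = 0 := by exact_mod_cast hd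
  have hD' : (Y2 - Y3) * e1 = q3 - q1 := by exact_mod_cast hD
  set W212 := klrPsiR k r' (i ∘ swap r r') * klrPsiR k r i * klrPsiR k r' i
  set W21 := klrPsiR k r' (i ∘ swap r r') * klrPsiR k r i
  set W12 := klrPsiR k r i * klrPsiR k r' i
  set P1 := klrPsiR k r i
  set P2 := klrPsiR k r' i
  set E := klrIdemR k i
  rw [← hp1, ← hp3, ← hp21, ← hq1', ← hq2', ← hq3, ← hQ1, ← hs1, ← he1, ← he13]
  have key : ∀ (a121 b121 a21 b21 a12 b12 a1 b1 a2 b2 a0 b0 : klrYAlg k (p := p) (n := n)),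
      a121 = b121 → a21 = b21 → a12 = b12 → a1 = b1 → a2 = b2 → a0 = b0 →
      W212 * a121 + W21 * a21 + W12 * a12 + P1 * a1 + P2 * a2 + E * a0 =
        W212 * b121 + W21 * b21 + W12 * b12 + P1 * b1 + P2 * b2 + E * b0 := by
    intros; subst_vars; rfl
  have eL : (W212 * (q2 : KLRAlgebra k p n) - W21) * ((q3 : KLRAlgebra k p n) * q1) -
      (E * (Q1 : KLRAlgebra k p n) * s1 - P1 * (p21 : KLRAlgebra k p n)) * ((p3 : KLRAlgebra k p n) * q1) -
      (W12 * (q3 : KLRAlgebra k p n) + P1 * (e1 : KLRAlgebra k p n) - P2 * (p3 : KLRAlgebra k p n) +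
        E * ((p1 : KLRAlgebra k p n) * p3)) * ((q2 : KLRAlgebra k p n) * p1) +
      (P1 * (q1 : KLRAlgebra k p n) - E * (p1 : KLRAlgebra k p n)) * p1 =
      W212 * ((q2 * (q3 * q1) : klrYAlg k (p := p) (n := n)) : KLRAlgebra k p n) +
        W21 * ((0 - q3 * q1 : klrYAlg k (p := p) (n := n)) : KLRAlgebra k p n) +
        W12 * ((0 - q3 * (q2 * p1) : klrYAlg k (p := p) (n := n)) : KLRAlgebra k p n) +
        P1 * ((p21 * (p3 * q1) - e1 * (q2 * p1) + q1 * p1 : klrYAlg k (p := p) (n := n)) : KLRAlgebra k p n) +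
        P2 * ((p3 * (q2 * p1) : klrYAlg k (p := p) (n := n)) : KLRAlgebra k p n) +
        E * ((0 - Q1 * s1 * (p3 * q1) - p1 * p3 * (q2 * p1) - p1 * p1 : klrYAlg k (p := p) (n := n)) :
          KLRAlgebra k p n) := by
    push_cast
    simp only [sub_mul, add_mul, mul_assoc, mul_add, mul_sub, mul_zero]
    abel
  have eR : (W212 * (q1 : KLRAlgebra k p n) + W21 * (e13 : KLRAlgebra k p n) - W12 * (p1 : KLRAlgebra k p n) -
        P1 * ((p3 : KLRAlgebra k p n) * p1)) * ((q3 : KLRAlgebra k p n) * q2) +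
      (W21 * (q3 : KLRAlgebra k p n) - P1 * (p3 : KLRAlgebra k p n)) * ((e1 : KLRAlgebra k p n) * q2) -
      P2 * ((p3 : KLRAlgebra k p n) * q2) +
      (P2 * (q2 : KLRAlgebra k p n) - E) * ((p1 : KLRAlgebra k p n) * p3 * q2) -
      (W21 * (q3 : KLRAlgebra k p n) - P1 * (p3 : KLRAlgebra k p n)) * q1 +
      (P2 * (q2 : KLRAlgebra k p n) - E) * p1 =
      W212 * ((q1 * (q3 * q2) : klrYAlg k (p := p) (n := n)) : KLRAlgebra k p n) +
        W21 * ((e13 * (q3 * q2) + q3 * (e1 * q2) - q3 * q1 : klrYAlg k (p := p) (n := n)) : KLRAlgebra k p n) +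
        W12 * ((0 - p1 * (q3 * q2) : klrYAlg k (p := p) (n := n)) : KLRAlgebra k p n) +
        P1 * ((0 - p3 * p1 * (q3 * q2) - p3 * (e1 * q2) + p3 * q1 : klrYAlg k (p := p) (n := n)) :
          KLRAlgebra k p n) +
        P2 * ((0 - p3 * q2 + q2 * (p1 * p3 * q2) + q2 * p1 : klrYAlg k (p := p) (n := n)) : KLRAlgebra k p n) +
        E * ((0 - p1 * p3 * q2 - p1 : klrYAlg k (p := p) (n := n)) : KLRAlgebra k p n) := by
    push_cast
    simp only [sub_mul, add_mul, mul_assoc, mul_add, mul_sub, mul_zero]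
    abel
  rw [eL, eR]
  apply key
  · ring
  · linear_combination (-(q3 * q2)) * hd'
  · ring
  · rw [h21']; linear_combination (q1 - e1 * q2) * hI3' + (-(q2 * p1 * p3)) * hD' + (p1 * p3 * q1) * hq2''
  · linear_combination (-q2) * hI3' + (-(q2 * p1 * p3)) * hq2''
  · linear_combination (-p3) * hQ' + (1 - p1) * hI3' + (p1 * p3 * (1 - p1)) * hq2''

open scoped IsMulCommutative in
/-- **BK Thm 3.3, braid relation on `ē(𝐢)`, case `i_r ≠ i_{r+1} = i_{r+2}`** (all four quiver
configurations of the pair `(i_r, i_{r+1})`). [folklore] -/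
theorem klrSR_braid_mul_klrIdemR_of_ne_eq :
    klrSR k r r' * (klrSR k r' r'' * (klrSR k r r' * klrIdemR k i)) =
      klrSR k r' r'' * (klrSR k r r' * (klrSR k r' r'' * klrIdemR k i)) := by
  have h1 : r ≠ r' := by intro e; rw [Fin.ext_iff] at e; omega
  have h2 : r ≠ r'' := by intro e; rw [Fin.ext_iff] at e; omega
  have hac : i r ≠ i r'' := fun e => hab (e.trans hbc.symm)
  have hS2 : i ∘ swap r' r'' = i := comp_swap_eq_self_of_eq hbc
  have hI3 := klrPR_sub_klrPR_far_of_ne_eq k hab hbc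
  have cep1 : klrIdemR k i * klrPR k r r' i = klrPR k r r' i * klrIdemR k i :=
    klrIdemR_mul_of_mem_klrYAlg k (klrPR_mem_klrYAlg k _ _ _) i
  have cep3 : klrIdemR k i * klrPR k r r'' i = klrPR k r r'' i * klrIdemR k i :=
    klrIdemR_mul_of_mem_klrYAlg k (klrPR_mem_klrYAlg k _ _ _) i
  have hA : klrPR k r r' i * (klrDelta k r' r'' i r - klrDelta k r' r'' i r') * klrPR k r r'' i =
      klrIdemR k i * (klrPR k r r' i * klrPR k r r'' i) := by
    rw [klrDelta_of_ne_of_ne k h1 h2, klrDelta_left' k h' hbc, sub_sub_cancel, ← cep1, mul_assoc]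
  have hA' : klrPR k r r'' i * (klrDelta k r' r'' i r - klrDelta k r' r'' i r'') * klrPR k r r' i =
      klrIdemR k i * (0 - klrPR k r r'' i * klrPR k r r' i) := by
    rw [klrDelta_of_ne_of_ne k h1 h2, klrDelta_right k hbc, mul_sub, mul_zero, sub_mul, zero_mul, ← cep3,
      mul_assoc, mul_sub, mul_zero]
  obtain ⟨p1, hp1⟩ : ∃ x : klrYAlg k (p := p) (n := n), (x : KLRAlgebra k p n) = klrPR k r r' i :=
    ⟨⟨_, klrPR_mem_klrYAlg k _ _ _⟩, rfl⟩
  obtain ⟨p3, hp3⟩ : ∃ x : klrYAlg k (p := p) (n := n), (x : KLRAlgebra k p n) = klrPR k r r'' i :=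
    ⟨⟨_, klrPR_mem_klrYAlg k _ _ _⟩, rfl⟩
  obtain ⟨Y2, hY2⟩ : ∃ x : klrYAlg k (p := p) (n := n), (x : KLRAlgebra k p n) = klrYR k r' :=
    ⟨⟨_, klrYR_mem_klrYAlg k _⟩, rfl⟩
  obtain ⟨Y3, hY3⟩ : ∃ x : klrYAlg k (p := p) (n := n), (x : KLRAlgebra k p n) = klrYR k r'' :=
    ⟨⟨_, klrYR_mem_klrYAlg k _⟩, rfl⟩
  have hI3' : p1 - p3 = p1 * p3 * (Y2 - Y3) := by
    rw [← hp1, ← hp3, ← hY2, ← hY3] at hI3; exact_mod_cast hI3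
  have hm13 : klrPR k r r' i * klrPR k r r'' i ∈ klrYAlg k (p := p) (n := n) :=
    mul_mem (klrPR_mem_klrYAlg k _ _ _) (klrPR_mem_klrYAlg k _ _ _)
  have hm31' : (0 : KLRAlgebra k p n) - klrPR k r r'' i * klrPR k r r' i ∈ klrYAlg k (p := p) (n := n) :=
    sub_mem (zero_mem _) (mul_mem (klrPR_mem_klrYAlg k _ _ _) (klrPR_mem_klrYAlg k _ _ _))
  by_cases hfw : i r' = i r + 1 <;> by_cases hbw : i r = i r' + 1
  · -- `i_r ⇄ i_{r+1}`: `q = -p`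
    have hfw' : i r'' = i r + 1 := by rw [← hbc]; exact hfw
    have hbw' : i r = i r'' + 1 := by rw [← hbc]; exact hbw
    refine klrSR_braid_mul_klrIdemR_of_ne_eq_aux k h h' hab hbc hm13 hm31' ?_ ?_ ?_ ?_
    · rw [klrQR_mul_klrPsiR_rule_of_fw_bw k h' i hab hfw hbw]
      simp only [swap_apply_left, swap_apply_of_ne_of_ne h1 h2, hS2]
      rw [hA]
    · rw [klrQR_mul_klrPsiR_rule_of_fw_bw k h' i hac hfw' hbw']
      simp only [swap_apply_right, swap_apply_of_ne_of_ne h1 h2, hS2]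
      rw [hA']
    · rw [← hp1, ← hp3]; exact_mod_cast (show p1 * p3 + (0 - p3 * p1) = 0 by ring)
    · have e2 : klrQR k r r' i = -klrPR k r r' i := by rw [klrQR, if_neg hab, if_pos hfw, if_pos hbw]
      have e3 : klrQR k r r'' i = -klrPR k r r'' i := by rw [klrQR, if_neg hac, if_pos hfw', if_pos hbw']
      rw [e2, e3, ← hp1, ← hp3, ← hY2, ← hY3]
      exact_mod_cast (show (Y2 - Y3) * (p1 * p3) = -p3 - -p1 by
        linear_combination (-1 : klrYAlg k (p := p) (n := n)) * hI3')
  · -- `i_r → i_{r+1}` only: `q = p² - p`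
    have hfw' : i r'' = i r + 1 := by rw [← hbc]; exact hfw
    have hbw' : ¬ i r = i r'' + 1 := by rw [← hbc]; exact hbw
    have hm2 : klrPR k r r' i * klrPR k r r'' i - klrPR k r r' i * klrPR k r r'' i * klrPR k r r'' i -
        klrPR k r r' i * (klrPR k r r' i * klrPR k r r'' i) ∈ klrYAlg k (p := p) (n := n) :=
      sub_mem (sub_mem hm13 (mul_mem hm13 (klrPR_mem_klrYAlg k _ _ _))) (mul_mem (klrPR_mem_klrYAlg k _ _ _) hm13)
    have hm3 : (0 - klrPR k r r'' i * klrPR k r r' i) - (0 - klrPR k r r'' i * klrPR k r r' i) * klrPR k r r' i -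
        klrPR k r r'' i * (0 - klrPR k r r'' i * klrPR k r r' i) ∈ klrYAlg k (p := p) (n := n) :=
      sub_mem (sub_mem hm31' (mul_mem hm31' (klrPR_mem_klrYAlg k _ _ _))) (mul_mem (klrPR_mem_klrYAlg k _ _ _) hm31')
    refine klrSR_braid_mul_klrIdemR_of_ne_eq_aux k h h' hab hbc hm2 hm3 ?_ ?_ ?_ ?_
    · rw [klrQR_mul_klrPsiR_rule_of_fw k h' i hab hfw hbw]
      simp only [swap_apply_left, swap_apply_of_ne_of_ne h1 h2, hS2]
      rw [hA, shape_fw_aux (klrIdemR k i) (klrPR k r r' i * klrPR k r r'' i) (klrPR k r r' i) (klrPR k r r'' i)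
        cep1.symm]
    · rw [klrQR_mul_klrPsiR_rule_of_fw k h' i hac hfw' hbw']
      simp only [swap_apply_right, swap_apply_of_ne_of_ne h1 h2, hS2]
      rw [hA', shape_fw_aux (klrIdemR k i) (0 - klrPR k r r'' i * klrPR k r r' i) (klrPR k r r'' i)
        (klrPR k r r' i) cep3.symm]
    · rw [← hp1, ← hp3]
      exact_mod_cast (show p1 * p3 - p1 * p3 * p3 - p1 * (p1 * p3) +
        ((0 - p3 * p1) - (0 - p3 * p1) * p1 - p3 * (0 - p3 * p1)) = 0 by ring)
    · have e2 : klrQR k r r' i = klrPR k r r' i * klrPR k r r' i - klrPR k r r' i := by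
        rw [klrQR, if_neg hab, if_pos hfw, if_neg hbw]
      have e3 : klrQR k r r'' i = klrPR k r r'' i * klrPR k r r'' i - klrPR k r r'' i := by
        rw [klrQR, if_neg hac, if_pos hfw', if_neg hbw']
      rw [e2, e3, ← hp1, ← hp3, ← hY2, ← hY3]
      exact_mod_cast (show (Y2 - Y3) * (p1 * p3 - p1 * p3 * p3 - p1 * (p1 * p3)) =
        p3 * p3 - p3 - (p1 * p1 - p1) by linear_combination (p3 + p1 - 1) * hI3')
  · -- `i_r ← i_{r+1}` only: `q = 1`
    have hfw' : ¬ i r'' = i r + 1 := by rw [← hbc]; exact hfw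
    have hbw' : i r = i r'' + 1 := by rw [← hbc]; exact hbw
    refine klrSR_braid_mul_klrIdemR_of_ne_eq_aux k h h' hab hbc (zero_mem _) (zero_mem _) ?_ ?_ ?_ ?_
    · rw [klrQR_mul_klrPsiR_rule_of_bw k (r := r') (r' := r'') i hab hfw hbw, mul_zero]
      simp only [swap_apply_left, swap_apply_of_ne_of_ne h1 h2, hS2]
    · rw [klrQR_mul_klrPsiR_rule_of_bw k (r := r') (r' := r'') i hac hfw' hbw', mul_zero]
      simp only [swap_apply_right, swap_apply_of_ne_of_ne h1 h2, hS2]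
    · rw [add_zero]
    · have e2 : klrQR k r r' i = 1 := by rw [klrQR, if_neg hab, if_neg hfw, if_pos hbw]
      have e3 : klrQR k r r'' i = 1 := by rw [klrQR, if_neg hac, if_neg hfw', if_pos hbw']
      rw [e2, e3, mul_zero, sub_self]
  · -- unrelated: `q = 1 - p`
    have hfw' : ¬ i r'' = i r + 1 := by rw [← hbc]; exact hfw
    have hbw' : ¬ i r = i r'' + 1 := by rw [← hbc]; exact hbw
    refine klrSR_braid_mul_klrIdemR_of_ne_eq_aux k h h' hab hbc hm13 hm31' ?_ ?_ ?_ ?_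
    · rw [klrQR_mul_klrPsiR_rule_of_ne k h' i hab hfw hbw]
      simp only [swap_apply_left, swap_apply_of_ne_of_ne h1 h2, hS2]
      rw [hA, shape_ne_aux]
    · rw [klrQR_mul_klrPsiR_rule_of_ne k h' i hac hfw' hbw']
      simp only [swap_apply_right, swap_apply_of_ne_of_ne h1 h2, hS2]
      rw [hA', shape_ne_aux]
    · rw [← hp1, ← hp3]; exact_mod_cast (show p1 * p3 + (0 - p3 * p1) = 0 by ring)
    · have e2 : klrQR k r r' i = 1 - klrPR k r r' i := by rw [klrQR, if_neg hab, if_neg hfw, if_neg hbw]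
      have e3 : klrQR k r r'' i = 1 - klrPR k r r'' i := by rw [klrQR, if_neg hac, if_neg hfw', if_neg hbw']
      rw [e2, e3, ← hp1, ← hp3, ← hY2, ← hY3]
      exact_mod_cast (show (Y2 - Y3) * (p1 * p3) = 1 - p3 - (1 - p1) by
        linear_combination (-1 : klrYAlg k (p := p) (n := n)) * hI3')

end

end BraidNeEq



/-! ### BK Thm 3.3, braid relation: the case `i_r = i_{r+2} ≠ i_{r+1}` -/

section BraidEqFar

variable (k : Type*) [Field k] (p n : ℕ) [Fact p.Prime] [CharP k p]

variable {p n}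

section
variable {r r' r'' : Fin n} (h : (r' : ℕ) = r + 1) (h' : (r'' : ℕ) = r' + 1) {i : Fin n → ZMod p}
  (hab : i r ≠ i r') (hac : i r = i r'')
include h h' hab hac

/-- `s_{r+1} P_r(𝐢) = P_{r+1}(s_r𝐢) P_r(𝐢) q_{r,r+2}(𝐢) - P_r(𝐢)` for `i_r = i_{r+2} ≠ i_{r+1}`. [folklore] -/
theorem klrSR_next_mul_klrPsiR_of_eq_far :
    klrSR k r' r'' * klrPsiR k r i =
      klrPsiR k r' (i ∘ swap r r') * klrPsiR k r i * klrQR k r r'' i - klrPsiR k r i := by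
  have h1 : r'' ≠ r := by intro e; rw [Fin.ext_iff] at e; omega
  have h2 : r'' ≠ r' := by intro e; rw [Fin.ext_iff] at e; omega
  have hj1 : (i ∘ swap r r') r' = (i ∘ swap r r') r'' := by
    simp only [Function.comp_apply, swap_apply_right, swap_apply_of_ne_of_ne h1 h2]; exact hac
  rw [klrSR_mul_of_top k (i ∘ swap r r') (klrIdemR_swap_mul_klrPsiR k h i), klrPR_of_eq k hj1, one_mul,
    klrQR_mul_klrPsiR_of_ne k h hab, ← mul_assoc]
  simp only [swap_apply_right, swap_apply_of_ne_of_ne h1 h2, comp_swap_comp_swap]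

/-- `s_r P_{r+1}(𝐢) = P_r(s_{r+1}𝐢) P_{r+1}(𝐢) q_{r,r+2}(𝐢) - P_{r+1}(𝐢)` for `i_r = i_{r+2} ≠ i_{r+1}`. [folklore] -/
theorem klrSR_mul_klrPsiR_next_of_eq_far :
    klrSR k r r' * klrPsiR k r' i =
      klrPsiR k r (i ∘ swap r' r'') * klrPsiR k r' i * klrQR k r r'' i - klrPsiR k r' i := by
  have h1 : r ≠ r' := by intro e; rw [Fin.ext_iff] at e; omega
  have h2 : r ≠ r'' := by intro e; rw [Fin.ext_iff] at e; omega
  have hbc : i r' ≠ i r'' := fun e => hab (hac.trans e.symm)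
  have hj2 : (i ∘ swap r' r'') r = (i ∘ swap r' r'') r' := by
    simp only [Function.comp_apply, swap_apply_left, swap_apply_of_ne_of_ne h1 h2]; exact hac
  rw [klrSR_mul_of_top k (i ∘ swap r' r'') (klrIdemR_swap_mul_klrPsiR k h' i), klrPR_of_eq k hj2, one_mul,
    klrQR_mul_klrPsiR_of_ne k h' hbc, ← mul_assoc]
  simp only [swap_apply_left, swap_apply_of_ne_of_ne h1 h2, comp_swap_comp_swap]

/-- `s_r (P_{r+1}(s_r𝐢) P_r(𝐢))` for `i_r = i_{r+2} ≠ i_{r+1}`, given the `∂`-datum `d_A` of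
`q_{r,r+1}(s_r𝐢)` through `P_{r+1}(s_r𝐢)` and its transport `d_A P_r(𝐢) = P_r(𝐢) d_B`. [folklore] -/
theorem klrSR_mul_klrPsiR_two_one_of_eq_far {dA dB : KLRAlgebra k p n}
    (hq1j : klrQR k r r' (i ∘ swap r r') * klrPsiR k r' (i ∘ swap r r') =
      klrPsiR k r' (i ∘ swap r r') * klrQR k r r'' (i ∘ swap r r') + klrIdemR k (i ∘ swap r r') * dA)
    (hdA : dA * klrPsiR k r i = klrPsiR k r i * dB) :
    klrSR k r r' * (klrPsiR k r' (i ∘ swap r r') * klrPsiR k r i) =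
      klrPsiR k r (i ∘ swap r r') * klrPsiR k r' (i ∘ swap r r') * klrPsiR k r i * klrQR k r' r'' i +
        klrIdemR k i * (klrQQ k r r' i * dB) -
        klrPsiR k r' (i ∘ swap r r') * klrPsiR k r i * klrPR k r' r'' i +
        klrPsiR k r i * (klrPR k r' r i * klrPR k r' r'' i) := by
  have h1 : r'' ≠ r := by intro e; rw [Fin.ext_iff] at e; omega
  have h2 : r'' ≠ r' := by intro e; rw [Fin.ext_iff] at e; omega
  set j := i ∘ swap r r' with hj
  have hj1 : j r' = j r'' := by
    simp only [hj, Function.comp_apply, swap_apply_right, swap_apply_of_ne_of_ne h1 h2]; exact hac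
  have hj1' : j r ≠ j r' := by
    simp only [hj, Function.comp_apply, swap_apply_left, swap_apply_right]; exact fun e => hab e.symm
  have hS : j ∘ swap r' r'' = j := comp_swap_eq_self_of_eq hj1
  have htop : klrIdemR k (j ∘ swap r' r'') * (klrPsiR k r' j * klrPsiR k r i) = klrPsiR k r' j * klrPsiR k r i := by
    rw [← mul_assoc, klrIdemR_swap_mul_klrPsiR k h']
  have cQQ : klrQQ k r r' i * klrIdemR k i = klrIdemR k i * klrQQ k r r' i :=
    (klrIdemR_mul_of_mem_klrYAlg k (klrQQ_mem_klrYAlg k r r' i) i).symm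
  -- the `q`-part
  have tq : klrQR k r r' j * (klrPsiR k r' j * klrPsiR k r i) =
      klrPsiR k r' j * klrPsiR k r i * klrQR k r' r'' i + klrPsiR k r i * dB := by
    rw [← mul_assoc, hq1j, add_mul, mul_assoc, klrQR_mul_klrPsiR_of_ne k h hab, mul_assoc, hdA, ← mul_assoc,
      ← mul_assoc (klrIdemR k j), hj, klrIdemR_swap_mul_klrPsiR k h]
    simp only [swap_apply_left, swap_apply_of_ne_of_ne h1 h2, comp_swap_comp_swap]
  -- the `p`-part
  have hEP : klrIdemR k (i ∘ swap r r') * klrPsiR k r i = klrPsiR k r i := klrIdemR_swap_mul_klrPsiR k h i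
  have tp : klrPR k r r' j * (klrPsiR k r' j * klrPsiR k r i) =
      klrPsiR k r' j * klrPsiR k r i * klrPR k r' r'' i - klrPsiR k r i * (klrPR k r' r i * klrPR k r' r'' i) := by
    rw [← mul_assoc, klrPR_mul_klrPsiR_next_of_ne_eq k h h' hj1' hj1, sub_mul, mul_assoc,
      klrPR_mul_klrPsiR_of_ne k h hab, mul_assoc, mul_assoc, klrPR_mul_klrPsiR_of_ne k h hab,
      ← mul_assoc (klrPR k r r' j), klrPR_mul_klrPsiR_of_ne k h hab]
    simp only [hj, swap_apply_left, swap_apply_right, swap_apply_of_ne_of_ne h1 h2, comp_swap_comp_swap,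
      ← mul_assoc, hEP]
  rw [klrSR_mul_of_top k _ htop, hS, tq, tp, mul_add, ← mul_assoc, ← mul_assoc, ← mul_assoc, hj,
    klrPsiR_sq' k h i, cQQ, mul_assoc (klrIdemR k i)]
  abel

/-- `s_{r+1} (P_r(s_{r+1}𝐢) P_{r+1}(𝐢))` for `i_r = i_{r+2} ≠ i_{r+1}`, given the `∂`-datum `d_C` of
`q_{r+1,r+2}(s_{r+1}𝐢)` through `P_r(s_{r+1}𝐢)` and its transport `d_C P_{r+1}(𝐢) = P_{r+1}(𝐢) d_D`. [folklore] -/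
theorem klrSR_next_mul_klrPsiR_one_two_of_eq_far {dC dD : KLRAlgebra k p n}
    (hq2j : klrQR k r' r'' (i ∘ swap r' r'') * klrPsiR k r (i ∘ swap r' r'') =
      klrPsiR k r (i ∘ swap r' r'') * klrQR k r r'' (i ∘ swap r' r'') + klrIdemR k (i ∘ swap r' r'') * dC)
    (hdC : dC * klrPsiR k r' i = klrPsiR k r' i * dD) :
    klrSR k r' r'' * (klrPsiR k r (i ∘ swap r' r'') * klrPsiR k r' i) =
      klrPsiR k r' (i ∘ swap r' r'') * klrPsiR k r (i ∘ swap r' r'') * klrPsiR k r' i * klrQR k r r' i +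
        klrIdemR k i * (klrQQ k r' r'' i * dD) -
        klrPsiR k r (i ∘ swap r' r'') * klrPsiR k r' i * klrPR k r r' i +
        klrPsiR k r' i * (klrPR k r'' r' i * klrPR k r r' i) := by
  have h1 : r ≠ r' := by intro e; rw [Fin.ext_iff] at e; omega
  have h2 : r ≠ r'' := by intro e; rw [Fin.ext_iff] at e; omega
  have hbc : i r' ≠ i r'' := fun e => hab (hac.trans e.symm)
  set j := i ∘ swap r' r'' with hj
  have hj2 : j r = j r' := by
    simp only [hj, Function.comp_apply, swap_apply_left, swap_apply_of_ne_of_ne h1 h2]; exact hac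
  have hj2' : j r ≠ j r'' := by
    simp only [hj, Function.comp_apply, swap_apply_right, swap_apply_of_ne_of_ne h1 h2]; exact hab
  have hS : j ∘ swap r r' = j := comp_swap_eq_self_of_eq hj2
  have htop : klrIdemR k (j ∘ swap r r') * (klrPsiR k r j * klrPsiR k r' i) = klrPsiR k r j * klrPsiR k r' i := by
    rw [← mul_assoc, klrIdemR_swap_mul_klrPsiR k h]
  have cQQ : klrQQ k r' r'' i * klrIdemR k i = klrIdemR k i * klrQQ k r' r'' i :=
    (klrIdemR_mul_of_mem_klrYAlg k (klrQQ_mem_klrYAlg k r' r'' i) i).symm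
  have tq : klrQR k r' r'' j * (klrPsiR k r j * klrPsiR k r' i) =
      klrPsiR k r j * klrPsiR k r' i * klrQR k r r' i + klrPsiR k r' i * dD := by
    rw [← mul_assoc, hq2j, add_mul, mul_assoc, klrQR_mul_klrPsiR_of_ne k h' hbc, mul_assoc, hdC, ← mul_assoc,
      ← mul_assoc (klrIdemR k j), hj, klrIdemR_swap_mul_klrPsiR k h']
    simp only [swap_apply_right, swap_apply_of_ne_of_ne h1 h2, comp_swap_comp_swap]
  have hEP : klrIdemR k (i ∘ swap r' r'') * klrPsiR k r' i = klrPsiR k r' i := klrIdemR_swap_mul_klrPsiR k h' i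
  have tp : klrPR k r' r'' j * (klrPsiR k r j * klrPsiR k r' i) =
      klrPsiR k r j * klrPsiR k r' i * klrPR k r r' i - klrPsiR k r' i * (klrPR k r'' r' i * klrPR k r r' i) := by
    rw [← mul_assoc, klrPR_next_mul_klrPsiR_of_eq_ne k h h' hj2 hj2', sub_mul, mul_assoc,
      klrPR_mul_klrPsiR_of_ne k h' hbc, mul_assoc, mul_assoc, klrPR_mul_klrPsiR_of_ne k h' hbc,
      ← mul_assoc (klrPR k r' r'' j), klrPR_mul_klrPsiR_of_ne k h' hbc]
    simp only [hj, swap_apply_left, swap_apply_right, swap_apply_of_ne_of_ne h1 h2, comp_swap_comp_swap,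
      ← mul_assoc, hEP]
  rw [klrSR_mul_of_top k _ htop, hS, tq, tp, mul_add, ← mul_assoc, ← mul_assoc, ← mul_assoc, hj,
    klrPsiR_sq' k h' i, cQQ, mul_assoc (klrIdemR k i)]
  abel

/-- **Normal form of `s_rs_{r+1}s_r ē(𝐢)` for `i_r = i_{r+2} ≠ i_{r+1}`.** [folklore] -/
theorem klrSR_triple_lhs_of_eq_far {dA dB : KLRAlgebra k p n}
    (hq1j : klrQR k r r' (i ∘ swap r r') * klrPsiR k r' (i ∘ swap r r') =
      klrPsiR k r' (i ∘ swap r r') * klrQR k r r'' (i ∘ swap r r') + klrIdemR k (i ∘ swap r r') * dA)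
    (hdA : dA * klrPsiR k r i = klrPsiR k r i * dB) :
    klrSR k r r' * (klrSR k r' r'' * (klrSR k r r' * klrIdemR k i)) =
      (klrPsiR k r (i ∘ swap r r') * klrPsiR k r' (i ∘ swap r r') * klrPsiR k r i * klrQR k r' r'' i +
        klrIdemR k i * (klrQQ k r r' i * dB) -
        klrPsiR k r' (i ∘ swap r r') * klrPsiR k r i * klrPR k r' r'' i +
        klrPsiR k r i * (klrPR k r' r i * klrPR k r' r'' i)) * (klrQR k r r'' i * klrQR k r r' i) -
      (klrIdemR k i * klrQQ k r r' i * klrQsR k r r' i - klrPsiR k r i * klrPR k r' r i) * klrQR k r r' i -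
      (klrPsiR k r (i ∘ swap r' r'') * klrPsiR k r' i * klrQR k r r'' i - klrPsiR k r' i) *
        (klrQR k r' r'' i * klrPR k r r' i) +
      (klrPsiR k r i * klrQR k r r' i - klrIdemR k i * klrPR k r r' i) * (klrPR k r' r'' i * klrPR k r r' i) := by
  rw [klrSR_mul_klrIdemR']
  have A2 : klrSR k r' r'' * (klrPsiR k r i * klrQR k r r' i - klrIdemR k i * klrPR k r r' i) =
      klrPsiR k r' (i ∘ swap r r') * klrPsiR k r i * (klrQR k r r'' i * klrQR k r r' i) -
        klrPsiR k r i * klrQR k r r' i - klrPsiR k r' i * (klrQR k r' r'' i * klrPR k r r' i) +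
        klrIdemR k i * (klrPR k r' r'' i * klrPR k r r' i) := by
    rw [mul_sub, ← mul_assoc, klrSR_next_mul_klrPsiR_of_eq_far k h h' hab hac, ← mul_assoc, klrSR_mul_klrIdemR']
    simp only [sub_mul, mul_assoc]
    abel
  rw [A2, mul_add, mul_sub, mul_sub, ← mul_assoc, klrSR_mul_klrPsiR_two_one_of_eq_far k h h' hab hac hq1j hdA,
    ← mul_assoc (klrSR k r r') (klrPsiR k r i), klrSR_mul_klrPsiR_same k h hab,
    ← mul_assoc (klrSR k r r') (klrPsiR k r' i), klrSR_mul_klrPsiR_next_of_eq_far k h h' hab hac,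
    ← mul_assoc (klrSR k r r') (klrIdemR k i), klrSR_mul_klrIdemR']

/-- **Normal form of `s_{r+1}s_rs_{r+1} ē(𝐢)` for `i_r = i_{r+2} ≠ i_{r+1}`.** [folklore] -/
theorem klrSR_triple_rhs_of_eq_far {dC dD : KLRAlgebra k p n}
    (hq2j : klrQR k r' r'' (i ∘ swap r' r'') * klrPsiR k r (i ∘ swap r' r'') =
      klrPsiR k r (i ∘ swap r' r'') * klrQR k r r'' (i ∘ swap r' r'') + klrIdemR k (i ∘ swap r' r'') * dC)
    (hdC : dC * klrPsiR k r' i = klrPsiR k r' i * dD) :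
    klrSR k r' r'' * (klrSR k r r' * (klrSR k r' r'' * klrIdemR k i)) =
      (klrPsiR k r' (i ∘ swap r' r'') * klrPsiR k r (i ∘ swap r' r'') * klrPsiR k r' i * klrQR k r r' i +
        klrIdemR k i * (klrQQ k r' r'' i * dD) -
        klrPsiR k r (i ∘ swap r' r'') * klrPsiR k r' i * klrPR k r r' i +
        klrPsiR k r' i * (klrPR k r'' r' i * klrPR k r r' i)) * (klrQR k r r'' i * klrQR k r' r'' i) -
      (klrIdemR k i * klrQQ k r' r'' i * klrQsR k r' r'' i - klrPsiR k r' i * klrPR k r'' r' i) * klrQR k r' r'' i -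
      (klrPsiR k r' (i ∘ swap r r') * klrPsiR k r i * klrQR k r r'' i - klrPsiR k r i) *
        (klrQR k r r' i * klrPR k r' r'' i) +
      (klrPsiR k r' i * klrQR k r' r'' i - klrIdemR k i * klrPR k r' r'' i) * (klrPR k r r' i * klrPR k r' r'' i) := by
  have hbc : i r' ≠ i r'' := fun e => hab (hac.trans e.symm)
  rw [klrSR_mul_klrIdemR']
  have B2 : klrSR k r r' * (klrPsiR k r' i * klrQR k r' r'' i - klrIdemR k i * klrPR k r' r'' i) =
      klrPsiR k r (i ∘ swap r' r'') * klrPsiR k r' i * (klrQR k r r'' i * klrQR k r' r'' i) -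
        klrPsiR k r' i * klrQR k r' r'' i - klrPsiR k r i * (klrQR k r r' i * klrPR k r' r'' i) +
        klrIdemR k i * (klrPR k r r' i * klrPR k r' r'' i) := by
    rw [mul_sub, ← mul_assoc, klrSR_mul_klrPsiR_next_of_eq_far k h h' hab hac, ← mul_assoc, klrSR_mul_klrIdemR']
    simp only [sub_mul, mul_assoc]
    abel
  rw [B2, mul_add, mul_sub, mul_sub, ← mul_assoc, klrSR_next_mul_klrPsiR_one_two_of_eq_far k h h' hab hac hq2j hdC,
    ← mul_assoc (klrSR k r' r'') (klrPsiR k r' i), klrSR_mul_klrPsiR_same k h' hbc,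
    ← mul_assoc (klrSR k r' r'') (klrPsiR k r i), klrSR_next_mul_klrPsiR_of_eq_far k h h' hab hac,
    ← mul_assoc (klrSR k r' r'') (klrIdemR k i), klrSR_mul_klrIdemR']

open scoped IsMulCommutative in
omit h h' in
/-- **`p_{r,r+1} + p_{r+1,r+2} - p_{r,r+1}p_{r+1,r+2} + p_{r,r+1}p_{r+1,r+2} q_{r,r+2} = 0`** for
`i_r = i_{r+2} ≠ i_{r+1}` (`1/p_{r,r+1} + 1/p_{r+1,r+2} = ȳ_r - ȳ_{r+2} = 1 - q_{r,r+2}`). [folklore] -/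
theorem klrPR_add_klrPR_of_eq_far :
    klrPR k r r' i + klrPR k r' r'' i - klrPR k r r' i * klrPR k r' r'' i +
      klrPR k r r' i * klrPR k r' r'' i * klrQR k r r'' i = 0 := by
  have hbc : i r' ≠ i r'' := fun e => hab (hac.trans e.symm)
  have hc1 : resK k (i r) - resK k (i r') ≠ 0 := resK_sub_ne_zero k hab
  have hc2 : resK k (i r') - resK k (i r'') ≠ 0 := resK_sub_ne_zero k hbc
  have hu1 := isUnit_klrDiffUnitR k (p := p) r r' hc1
  have hu2 := isUnit_klrDiffUnitR k (p := p) r' r'' hc2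
  have e1 : klrPR k r r' i = Ring.inverse (klrDiffUnitR k r r' (resK k (i r) - resK k (i r'))) := if_neg hab
  have e2 : klrPR k r' r'' i = Ring.inverse (klrDiffUnitR k r' r'' (resK k (i r') - resK k (i r''))) := if_neg hbc
  have hq3 : klrQR k r r'' i = 1 + (klrYR k r'' - klrYR k r) := by rw [klrQR, if_pos hac]
  have hU : klrDiffUnitR k (p := p) r r' (resK k (i r) - resK k (i r')) +
      klrDiffUnitR k r' r'' (resK k (i r') - resK k (i r'')) = 1 - klrQR k r r'' i := by
    rw [hq3, klrDiffUnitR, klrDiffUnitR, ← hac, map_sub, map_sub]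
    abel
  have R1 := Ring.inverse_mul_cancel _ hu1
  have R2 := Ring.inverse_mul_cancel _ hu2
  rw [← e1] at R1
  rw [← e2] at R2
  obtain ⟨p1, hp1⟩ : ∃ x : klrYAlg k (p := p) (n := n), (x : KLRAlgebra k p n) = klrPR k r r' i :=
    ⟨⟨_, klrPR_mem_klrYAlg k _ _ _⟩, rfl⟩
  obtain ⟨p2, hp2⟩ : ∃ x : klrYAlg k (p := p) (n := n), (x : KLRAlgebra k p n) = klrPR k r' r'' i :=
    ⟨⟨_, klrPR_mem_klrYAlg k _ _ _⟩, rfl⟩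
  obtain ⟨u1, hu1'⟩ : ∃ x : klrYAlg k (p := p) (n := n), (x : KLRAlgebra k p n) =
      klrDiffUnitR k r r' (resK k (i r) - resK k (i r')) := ⟨⟨_, klrDiffUnitR_mem_klrYAlg k _ _ _⟩, rfl⟩
  obtain ⟨u2, hu2'⟩ : ∃ x : klrYAlg k (p := p) (n := n), (x : KLRAlgebra k p n) =
      klrDiffUnitR k r' r'' (resK k (i r') - resK k (i r'')) := ⟨⟨_, klrDiffUnitR_mem_klrYAlg k _ _ _⟩, rfl⟩
  obtain ⟨q3, hq3'⟩ : ∃ x : klrYAlg k (p := p) (n := n), (x : KLRAlgebra k p n) = klrQR k r r'' i :=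
    ⟨⟨_, klrQR_mem_klrYAlg k _ _ _⟩, rfl⟩
  rw [← hp1, ← hu1'] at R1
  rw [← hp2, ← hu2'] at R2
  rw [← hu1', ← hu2', ← hq3'] at hU
  have R1' : p1 * u1 = 1 := by exact_mod_cast R1
  have R2' : p2 * u2 = 1 := by exact_mod_cast R2
  have hU' : u1 + u2 = 1 - q3 := by exact_mod_cast hU
  rw [← hp1, ← hp2, ← hq3']
  exact_mod_cast (show p1 + p2 - p1 * p2 + p1 * p2 * q3 = 0 by
    linear_combination (-p1) * R2' + (-p2) * R1' + (p1 * p2) * hU')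

open scoped IsMulCommutative in
/-- **BK Thm 3.3, braid relation on `ē(𝐢)` for `i_r = i_{r+2} ≠ i_{r+1}`, given the `∂`-data at the
two neighbouring idempotents, the (R7) correction `Z` and the core identity
`Q_r d_B q_r - Q_{r+1} d_D q_{r+1} + Z q_r q_{r+1} = p_r p_{r+1} (p_r - p_{r+1})`.** [folklore] -/
theorem klrSR_braid_mul_klrIdemR_of_eq_far_aux {dA dB dC dD Z : KLRAlgebra k p n}
    (hdBm : dB ∈ klrYAlg k (p := p) (n := n)) (hdDm : dD ∈ klrYAlg k (p := p) (n := n))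
    (hZm : Z ∈ klrYAlg k (p := p) (n := n))
    (hq1j : klrQR k r r' (i ∘ swap r r') * klrPsiR k r' (i ∘ swap r r') =
      klrPsiR k r' (i ∘ swap r r') * klrQR k r r'' (i ∘ swap r r') + klrIdemR k (i ∘ swap r r') * dA)
    (hdA : dA * klrPsiR k r i = klrPsiR k r i * dB)
    (hq2j : klrQR k r' r'' (i ∘ swap r' r'') * klrPsiR k r (i ∘ swap r' r'') =
      klrPsiR k r (i ∘ swap r' r'') * klrQR k r r'' (i ∘ swap r' r'') + klrIdemR k (i ∘ swap r' r'') * dC)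
    (hdC : dC * klrPsiR k r' i = klrPsiR k r' i * dD)
    (hbr : klrPsiR k r (i ∘ swap r r') * klrPsiR k r' (i ∘ swap r r') * klrPsiR k r i =
      klrPsiR k r' (i ∘ swap r' r'') * klrPsiR k r (i ∘ swap r' r'') * klrPsiR k r' i + klrIdemR k i * Z)
    (hcore : klrQQ k r r' i * dB * klrQR k r r' i - klrQQ k r' r'' i * dD * klrQR k r' r'' i +
      Z * klrQR k r r' i * klrQR k r' r'' i = klrPR k r r' i * klrPR k r' r'' i * (klrPR k r r' i - klrPR k r' r'' i)) :
    klrSR k r r' * (klrSR k r' r'' * (klrSR k r r' * klrIdemR k i)) =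
      klrSR k r' r'' * (klrSR k r r' * (klrSR k r' r'' * klrIdemR k i)) := by
  have hbc : i r' ≠ i r'' := fun e => hab (hac.trans e.symm)
  rw [klrSR_triple_lhs_of_eq_far k h h' hab hac hq1j hdA, klrSR_triple_rhs_of_eq_far k h h' hab hac hq2j hdC, hbr]
  have hP := klrPR_add_klrPR_of_eq_far k hab hac
  have hQa := klrQuadratic_scalar' k (r := r) (r' := r') hab
  have hQb := klrQuadratic_scalar' k (r := r') (r' := r'') hbc
  have h21 := klrPR_rev k (r := r) (r' := r') hab
  have h32 := klrPR_rev k (r := r') (r' := r'') hbc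
  obtain ⟨p1, hp1⟩ : ∃ x : klrYAlg k (p := p) (n := n), (x : KLRAlgebra k p n) = klrPR k r r' i :=
    ⟨⟨_, klrPR_mem_klrYAlg k _ _ _⟩, rfl⟩
  obtain ⟨p2, hp2⟩ : ∃ x : klrYAlg k (p := p) (n := n), (x : KLRAlgebra k p n) = klrPR k r' r'' i :=
    ⟨⟨_, klrPR_mem_klrYAlg k _ _ _⟩, rfl⟩
  obtain ⟨p21, hp21⟩ : ∃ x : klrYAlg k (p := p) (n := n), (x : KLRAlgebra k p n) = klrPR k r' r i :=
    ⟨⟨_, klrPR_mem_klrYAlg k _ _ _⟩, rfl⟩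
  obtain ⟨p32, hp32⟩ : ∃ x : klrYAlg k (p := p) (n := n), (x : KLRAlgebra k p n) = klrPR k r'' r' i :=
    ⟨⟨_, klrPR_mem_klrYAlg k _ _ _⟩, rfl⟩
  obtain ⟨q1, hq1⟩ : ∃ x : klrYAlg k (p := p) (n := n), (x : KLRAlgebra k p n) = klrQR k r r' i :=
    ⟨⟨_, klrQR_mem_klrYAlg k _ _ _⟩, rfl⟩
  obtain ⟨q2, hq2⟩ : ∃ x : klrYAlg k (p := p) (n := n), (x : KLRAlgebra k p n) = klrQR k r' r'' i :=
    ⟨⟨_, klrQR_mem_klrYAlg k _ _ _⟩, rfl⟩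
  obtain ⟨q3, hq3⟩ : ∃ x : klrYAlg k (p := p) (n := n), (x : KLRAlgebra k p n) = klrQR k r r'' i :=
    ⟨⟨_, klrQR_mem_klrYAlg k _ _ _⟩, rfl⟩
  obtain ⟨Q1, hQ1⟩ : ∃ x : klrYAlg k (p := p) (n := n), (x : KLRAlgebra k p n) = klrQQ k r r' i :=
    ⟨⟨_, klrQQ_mem_klrYAlg k _ _ _⟩, rfl⟩
  obtain ⟨Q2, hQ2⟩ : ∃ x : klrYAlg k (p := p) (n := n), (x : KLRAlgebra k p n) = klrQQ k r' r'' i :=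
    ⟨⟨_, klrQQ_mem_klrYAlg k _ _ _⟩, rfl⟩
  obtain ⟨s1, hs1⟩ : ∃ x : klrYAlg k (p := p) (n := n), (x : KLRAlgebra k p n) = klrQsR k r r' i :=
    ⟨⟨_, klrQsR_mem_klrYAlg k _ _ _⟩, rfl⟩
  obtain ⟨s2, hs2⟩ : ∃ x : klrYAlg k (p := p) (n := n), (x : KLRAlgebra k p n) = klrQsR k r' r'' i :=
    ⟨⟨_, klrQsR_mem_klrYAlg k _ _ _⟩, rfl⟩
  obtain ⟨eB, heB⟩ : ∃ x : klrYAlg k (p := p) (n := n), (x : KLRAlgebra k p n) = dB := ⟨⟨_, hdBm⟩, rfl⟩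
  obtain ⟨eD, heD⟩ : ∃ x : klrYAlg k (p := p) (n := n), (x : KLRAlgebra k p n) = dD := ⟨⟨_, hdDm⟩, rfl⟩
  obtain ⟨z, hz⟩ : ∃ x : klrYAlg k (p := p) (n := n), (x : KLRAlgebra k p n) = Z := ⟨⟨_, hZm⟩, rfl⟩
  rw [← hp1, ← hp2, ← hq3] at hP
  rw [← hQ1, ← hs1, ← hq1, ← hp1] at hQa
  rw [← hQ2, ← hs2, ← hq2, ← hp2] at hQb
  rw [← hp1, ← hp21] at h21
  rw [← hp2, ← hp32] at h32
  rw [← hQ1, ← heB, ← hq1, ← hQ2, ← heD, ← hq2, ← hz, ← hp1, ← hp2] at hcore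
  have hP' : p1 + p2 - p1 * p2 + p1 * p2 * q3 = 0 := by exact_mod_cast hP
  have hQa' : Q1 * s1 * q1 + p1 * p1 = 1 := by exact_mod_cast hQa
  have hQb' : Q2 * s2 * q2 + p2 * p2 = 1 := by exact_mod_cast hQb
  have h21' : p21 = -p1 := by exact_mod_cast h21
  have h32' : p32 = -p2 := by exact_mod_cast h32
  have hcore' : Q1 * eB * q1 - Q2 * eD * q2 + z * q1 * q2 = p1 * p2 * (p1 - p2) := by exact_mod_cast hcore
  set W212 := klrPsiR k r' (i ∘ swap r' r'') * klrPsiR k r (i ∘ swap r' r'') * klrPsiR k r' i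
  set W21 := klrPsiR k r' (i ∘ swap r r') * klrPsiR k r i
  set W12 := klrPsiR k r (i ∘ swap r' r'') * klrPsiR k r' i
  set P1 := klrPsiR k r i
  set P2 := klrPsiR k r' i
  set E := klrIdemR k i
  rw [← hp1, ← hp2, ← hp21, ← hp32, ← hq1, ← hq2, ← hq3, ← hQ1, ← hQ2, ← hs1, ← hs2, ← heB, ← heD, ← hz]
  have key : ∀ (a121 b121 a21 b21 a12 b12 a1 b1 a2 b2 a0 b0 : klrYAlg k (p := p) (n := n)),
      a121 = b121 → a21 = b21 → a12 = b12 → a1 = b1 → a2 = b2 → a0 = b0 →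
      W212 * a121 + W21 * a21 + W12 * a12 + P1 * a1 + P2 * a2 + E * a0 =
        W212 * b121 + W21 * b21 + W12 * b12 + P1 * b1 + P2 * b2 + E * b0 := by
    intros; subst_vars; rfl
  have eL : ((W212 + E * (z : KLRAlgebra k p n)) * q2 + E * ((Q1 : KLRAlgebra k p n) * eB) -
        W21 * (p2 : KLRAlgebra k p n) + P1 * ((p21 : KLRAlgebra k p n) * p2)) * ((q3 : KLRAlgebra k p n) * q1) -
      (E * (Q1 : KLRAlgebra k p n) * s1 - P1 * (p21 : KLRAlgebra k p n)) * q1 -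
      (W12 * (q3 : KLRAlgebra k p n) - P2) * ((q2 : KLRAlgebra k p n) * p1) +
      (P1 * (q1 : KLRAlgebra k p n) - E * (p1 : KLRAlgebra k p n)) * ((p2 : KLRAlgebra k p n) * p1) =
      W212 * ((q2 * (q3 * q1) : klrYAlg k (p := p) (n := n)) : KLRAlgebra k p n) +
        W21 * ((0 - p2 * (q3 * q1) : klrYAlg k (p := p) (n := n)) : KLRAlgebra k p n) +
        W12 * ((0 - q3 * (q2 * p1) : klrYAlg k (p := p) (n := n)) : KLRAlgebra k p n) +
        P1 * ((p21 * p2 * (q3 * q1) + p21 * q1 + q1 * (p2 * p1) : klrYAlg k (p := p) (n := n)) :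
          KLRAlgebra k p n) +
        P2 * ((q2 * p1 : klrYAlg k (p := p) (n := n)) : KLRAlgebra k p n) +
        E * ((z * q2 * (q3 * q1) + Q1 * eB * (q3 * q1) - Q1 * s1 * q1 - p1 * (p2 * p1) :
          klrYAlg k (p := p) (n := n)) : KLRAlgebra k p n) := by
    push_cast
    simp only [sub_mul, add_mul, mul_assoc, mul_add, mul_sub, mul_zero]
    abel
  have eR : (W212 * (q1 : KLRAlgebra k p n) + E * ((Q2 : KLRAlgebra k p n) * eD) - W12 * (p1 : KLRAlgebra k p n) +
        P2 * ((p32 : KLRAlgebra k p n) * p1)) * ((q3 : KLRAlgebra k p n) * q2) -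
      (E * (Q2 : KLRAlgebra k p n) * s2 - P2 * (p32 : KLRAlgebra k p n)) * q2 -
      (W21 * (q3 : KLRAlgebra k p n) - P1) * ((q1 : KLRAlgebra k p n) * p2) +
      (P2 * (q2 : KLRAlgebra k p n) - E * (p2 : KLRAlgebra k p n)) * ((p1 : KLRAlgebra k p n) * p2) =
      W212 * ((q1 * (q3 * q2) : klrYAlg k (p := p) (n := n)) : KLRAlgebra k p n) +
        W21 * ((0 - q3 * (q1 * p2) : klrYAlg k (p := p) (n := n)) : KLRAlgebra k p n) +
        W12 * ((0 - p1 * (q3 * q2) : klrYAlg k (p := p) (n := n)) : KLRAlgebra k p n) +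
        P1 * ((q1 * p2 : klrYAlg k (p := p) (n := n)) : KLRAlgebra k p n) +
        P2 * ((p32 * p1 * (q3 * q2) + p32 * q2 + q2 * (p1 * p2) : klrYAlg k (p := p) (n := n)) :
          KLRAlgebra k p n) +
        E * ((Q2 * eD * (q3 * q2) - Q2 * s2 * q2 - p2 * (p1 * p2) : klrYAlg k (p := p) (n := n)) :
          KLRAlgebra k p n) := by
    push_cast
    simp only [sub_mul, add_mul, mul_assoc, mul_add, mul_sub, mul_zero]
    abel
  rw [eL, eR]
  apply key
  · ring
  · ring
  · ring
  · rw [h21']; linear_combination (-q1) * hP'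
  · rw [h32']; linear_combination q2 * hP'
  · linear_combination q3 * hcore' + (-1 : klrYAlg k (p := p) (n := n)) * hQa' + hQb' + (p1 - p2) * hP'

open scoped IsMulCommutative in
/-- **BK Thm 3.3, braid relation on `ē(𝐢)`, case `i_r = i_{r+2} ≠ i_{r+1}`** (all four quiver
configurations of the pair `(i_r, i_{r+1})`; the (R7) correction `Z ∈ {ȳ_r - 2ȳ_{r+1} + ȳ_{r+2}, 1, -1, 0}`
enters the coefficient of `ē(𝐢)`). [folklore] -/
theorem klrSR_braid_mul_klrIdemR_of_eq_far :
    klrSR k r r' * (klrSR k r' r'' * (klrSR k r r' * klrIdemR k i)) =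
      klrSR k r' r'' * (klrSR k r r' * (klrSR k r' r'' * klrIdemR k i)) := by
  have h1 : r ≠ r' := by intro e; rw [Fin.ext_iff] at e; omega
  have h2 : r ≠ r'' := by intro e; rw [Fin.ext_iff] at e; omega
  have h3 : r' ≠ r'' := by intro e; rw [Fin.ext_iff] at e; omega
  have hbc : i r' ≠ i r'' := fun e => hab (hac.trans e.symm)
  have hfwc : i r'' = i r' + 1 ↔ i r = i r' + 1 := by rw [hac]
  have hbwc : i r' = i r'' + 1 ↔ i r' = i r + 1 := by rw [hac]
  set j1 := i ∘ swap r r' with hj1d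
  set j2 := i ∘ swap r' r'' with hj2d
  have v1r : j1 r = i r' := by simp only [hj1d, Function.comp_apply, swap_apply_left]
  have v1r' : j1 r' = i r := by simp only [hj1d, Function.comp_apply, swap_apply_right]
  have v1r'' : j1 r'' = i r'' := by simp only [hj1d, Function.comp_apply, swap_apply_of_ne_of_ne h2.symm h3.symm]
  have v2r : j2 r = i r := by simp only [hj2d, Function.comp_apply, swap_apply_of_ne_of_ne h1 h2]
  have v2r' : j2 r' = i r'' := by simp only [hj2d, Function.comp_apply, swap_apply_left]
  have v2r'' : j2 r'' = i r' := by simp only [hj2d, Function.comp_apply, swap_apply_right]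
  have hj1 : j1 r' = j1 r'' := by rw [v1r', v1r'']; exact hac
  have hj1' : j1 r ≠ j1 r' := by rw [v1r, v1r']; exact fun e => hab e.symm
  have hj2 : j2 r = j2 r' := by rw [v2r, v2r']; exact hac
  have hj2' : j2 r' ≠ j2 r'' := by rw [v2r', v2r'']; exact fun e => hbc e.symm
  have hS1 : j1 ∘ swap r' r'' = j1 := comp_swap_eq_self_of_eq hj1
  have hS2 : j2 ∘ swap r r' = j2 := comp_swap_eq_self_of_eq hj2
  -- commuting idempotents and the `∂`-terms of the `p`'s
  have cep1j : klrIdemR k j1 * klrPR k r r' j1 = klrPR k r r' j1 * klrIdemR k j1 :=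
    klrIdemR_mul_of_mem_klrYAlg k (klrPR_mem_klrYAlg k _ _ _) j1
  have cep2j : klrIdemR k j2 * klrPR k r' r'' j2 = klrPR k r' r'' j2 * klrIdemR k j2 :=
    klrIdemR_mul_of_mem_klrYAlg k (klrPR_mem_klrYAlg k _ _ _) j2
  have hAj1 : klrPR k r r' j1 * (klrDelta k r' r'' j1 r - klrDelta k r' r'' j1 r') * klrPR k r r'' j1 =
      klrIdemR k j1 * (klrPR k r r' j1 * klrPR k r r'' j1) := by
    rw [klrDelta_of_ne_of_ne k h1 h2, klrDelta_left' k h' hj1, sub_sub_cancel, ← cep1j, mul_assoc]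
  have hAj2 : klrPR k r' r'' j2 * (klrDelta k r r' j2 r' - klrDelta k r r' j2 r'') * klrPR k r r'' j2 =
      klrIdemR k j2 * (klrPR k r' r'' j2 * klrPR k r r'' j2) := by
    rw [klrDelta_right k hj2, klrDelta_of_ne_of_ne k h2.symm h3.symm, sub_zero, ← cep2j, mul_assoc]
  -- moves through `P_r(𝐢)` and `P_{r+1}(𝐢)`
  have mv1 : klrPR k r r' j1 * klrPsiR k r i = klrPsiR k r i * klrPR k r' r i := by
    rw [hj1d, klrPR_mul_klrPsiR_of_ne k h hab]; simp only [swap_apply_left, swap_apply_right, comp_swap_comp_swap]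
  have mv2 : klrPR k r r'' j1 * klrPsiR k r i = klrPsiR k r i * klrPR k r' r'' i := by
    rw [hj1d, klrPR_mul_klrPsiR_of_ne k h hab]
    simp only [swap_apply_left, swap_apply_of_ne_of_ne h2.symm h3.symm, comp_swap_comp_swap]
  have mv3 : klrPR k r' r'' j2 * klrPsiR k r' i = klrPsiR k r' i * klrPR k r'' r' i := by
    rw [hj2d, klrPR_mul_klrPsiR_of_ne k h' hbc]; simp only [swap_apply_left, swap_apply_right, comp_swap_comp_swap]
  have mv4 : klrPR k r r'' j2 * klrPsiR k r' i = klrPsiR k r' i * klrPR k r r' i := by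
    rw [hj2d, klrPR_mul_klrPsiR_of_ne k h' hbc]
    simp only [swap_apply_right, swap_apply_of_ne_of_ne h1 h2, comp_swap_comp_swap]
  have mv1' : klrPR k r r' j1 * klrPsiR k r i = klrPsiR k r i * klrPR k r' r i + 0 := by rw [mv1, add_zero]
  have mv2' : klrPR k r r'' j1 * klrPsiR k r i = klrPsiR k r i * klrPR k r' r'' i + 0 := by rw [mv2, add_zero]
  have mv3' : klrPR k r' r'' j2 * klrPsiR k r' i = klrPsiR k r' i * klrPR k r'' r' i + 0 := by rw [mv3, add_zero]
  have mv4' : klrPR k r r'' j2 * klrPsiR k r' i = klrPsiR k r' i * klrPR k r r' i + 0 := by rw [mv4, add_zero]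
  have hdAa : klrPR k r r' j1 * klrPR k r r'' j1 * klrPsiR k r i =
      klrPsiR k r i * (klrPR k r' r i * klrPR k r' r'' i) := by
    rw [mul_assoc, mv2, ← mul_assoc, mv1, mul_assoc]
  have hdCc : klrPR k r' r'' j2 * klrPR k r r'' j2 * klrPsiR k r' i =
      klrPsiR k r' i * (klrPR k r'' r' i * klrPR k r r' i) := by
    rw [mul_assoc, mv4, ← mul_assoc, mv3, mul_assoc]
  -- (R7) with its correction
  have hbr0 := klrPsiR_braid k h h' i
  rw [if_pos ⟨hac, hab⟩, ← hj1d, ← hj2d, hS1, hS2] at hbr0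
  -- memberships
  have hmB : klrPR k r' r i * klrPR k r' r'' i ∈ klrYAlg k (p := p) (n := n) :=
    mul_mem (klrPR_mem_klrYAlg k _ _ _) (klrPR_mem_klrYAlg k _ _ _)
  have hmD : klrPR k r'' r' i * klrPR k r r' i ∈ klrYAlg k (p := p) (n := n) :=
    mul_mem (klrPR_mem_klrYAlg k _ _ _) (klrPR_mem_klrYAlg k _ _ _)
  -- unit relations for the core identity
  have hu1 : IsUnit (klrDiffUnitR k (p := p) r r' (resK k (i r) - resK k (i r'))) :=
    isUnit_klrDiffUnitR k r r' (resK_sub_ne_zero k hab)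
  have hu2 : IsUnit (klrDiffUnitR k (p := p) r' r'' (resK k (i r') - resK k (i r''))) :=
    isUnit_klrDiffUnitR k r' r'' (resK_sub_ne_zero k hbc)
  have Ra1 := Ring.inverse_mul_cancel _ hu1
  have Ra2 := Ring.inverse_mul_cancel _ hu2
  rw [← show klrPR k r r' i = Ring.inverse _ from if_neg hab, klrDiffUnitR] at Ra1
  rw [← show klrPR k r' r'' i = Ring.inverse _ from if_neg hbc, klrDiffUnitR, ← hac] at Ra2
  obtain ⟨p1, hp1⟩ : ∃ x : klrYAlg k (p := p) (n := n), (x : KLRAlgebra k p n) = klrPR k r r' i :=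
    ⟨⟨_, klrPR_mem_klrYAlg k _ _ _⟩, rfl⟩
  obtain ⟨p2, hp2⟩ : ∃ x : klrYAlg k (p := p) (n := n), (x : KLRAlgebra k p n) = klrPR k r' r'' i :=
    ⟨⟨_, klrPR_mem_klrYAlg k _ _ _⟩, rfl⟩
  obtain ⟨p21, hp21⟩ : ∃ x : klrYAlg k (p := p) (n := n), (x : KLRAlgebra k p n) = klrPR k r' r i :=
    ⟨⟨_, klrPR_mem_klrYAlg k _ _ _⟩, rfl⟩
  obtain ⟨p32, hp32⟩ : ∃ x : klrYAlg k (p := p) (n := n), (x : KLRAlgebra k p n) = klrPR k r'' r' i :=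
    ⟨⟨_, klrPR_mem_klrYAlg k _ _ _⟩, rfl⟩
  obtain ⟨Y1, hY1⟩ : ∃ x : klrYAlg k (p := p) (n := n), (x : KLRAlgebra k p n) = klrYR k r :=
    ⟨⟨_, klrYR_mem_klrYAlg k _⟩, rfl⟩
  obtain ⟨Y2, hY2⟩ : ∃ x : klrYAlg k (p := p) (n := n), (x : KLRAlgebra k p n) = klrYR k r' :=
    ⟨⟨_, klrYR_mem_klrYAlg k _⟩, rfl⟩
  obtain ⟨Y3, hY3⟩ : ∃ x : klrYAlg k (p := p) (n := n), (x : KLRAlgebra k p n) = klrYR k r'' :=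
    ⟨⟨_, klrYR_mem_klrYAlg k _⟩, rfl⟩
  have h21 := klrPR_rev k (r := r) (r' := r') hab
  have h32 := klrPR_rev k (r := r') (r' := r'') hbc
  rw [← hp1, ← hp21] at h21
  rw [← hp2, ← hp32] at h32
  have h21' : p21 = -p1 := by exact_mod_cast h21
  have h32' : p32 = -p2 := by exact_mod_cast h32
  rw [← hp1, ← hY1, ← hY2] at Ra1
  rw [← hp2, ← hY2, ← hY3] at Ra2
  -- the four quiver configurations
  by_cases hfw : i r' = i r + 1 <;> by_cases hbw : i r = i r' + 1
  · -- `i_r ⇄ i_{r+1}` (characteristic 2)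
    have h2k : (2 : k) = 0 := by
      have e1 := congrArg (resK k) hfw
      have e2 := congrArg (resK k) hbw
      simp only [map_add, map_one] at e1 e2
      linear_combination -(e1 + e2)
    have h2S : (2 : klrYAlg k (p := p) (n := n)) = 0 := by
      have := congrArg (algebraMap k (klrYAlg k (p := p) (n := n))) h2k
      rwa [map_ofNat, map_zero] at this
    rw [show resK k (i r) - resK k (i r') = 1 by rw [hbw]; unfold resK; rw [map_add, map_one]; ring, map_one] at Ra1
    rw [show resK k (i r') - resK k (i r) = 1 by rw [hfw]; unfold resK; rw [map_add, map_one]; ring, map_one] at Ra2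
    have hR1 : p1 * (Y1 - Y2) = 1 - p1 := by
      have : p1 * (1 + (Y1 - Y2)) = 1 := by exact_mod_cast Ra1
      linear_combination this
    have hR2 : p2 * (Y2 - Y3) = 1 - p2 := by
      have : p2 * (1 + (Y2 - Y3)) = 1 := by exact_mod_cast Ra2
      linear_combination this
    have two_mem : (2 : KLRAlgebra k p n) ∈ klrYAlg k (p := p) (n := n) := by
      have := Subalgebra.natCast_mem (klrYAlg k (p := p) (n := n)) 2
      exact_mod_cast this
    have hZm : klrYR k r - 2 * klrYR k r' + klrYR k r'' ∈ klrYAlg k (p := p) (n := n) :=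
      add_mem (sub_mem (klrYR_mem_klrYAlg k _) (mul_mem two_mem (klrYR_mem_klrYAlg k _))) (klrYR_mem_klrYAlg k _)
    refine klrSR_braid_mul_klrIdemR_of_eq_far_aux k h h' hab hac hmB hmD hZm ?_ hdAa ?_ hdCc ?_ ?_
    · rw [klrQR_mul_klrPsiR_rule_of_fw_bw k h' j1 hj1' (by rw [v1r', v1r]; exact hbw) (by rw [v1r, v1r']; exact hfw)]
      simp only [swap_apply_of_ne_of_ne h1 h2, swap_apply_left, hS1]
      rw [hAj1]
    · rw [klrQR_mul_klrPsiR_rule_of_fw_bw k h j2 hj2' (by rw [v2r'', v2r']; exact hbwc.2 hfw)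
        (by rw [v2r', v2r'']; exact hfwc.2 hbw)]
      simp only [swap_apply_right, swap_apply_of_ne_of_ne h2.symm h3.symm, hS2]
      rw [hAj2]
    · rw [if_pos hfw, if_pos hbw, ← klrIdemR_mul_of_mem_klrYAlg k hZm i] at hbr0
      exact hbr0
    · rw [klrQQ, if_neg hab, if_pos hfw, if_pos hbw, klrQQ, if_neg hbc, if_pos (hfwc.2 hbw), if_pos (hbwc.2 hfw),
        klrQR, if_neg hab, if_pos hfw, if_pos hbw, klrQR, if_neg hbc, if_pos (hfwc.2 hbw), if_pos (hbwc.2 hfw),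
        ← hp1, ← hp2, ← hp21, ← hp32, ← hY1, ← hY2, ← hY3, two_mul]
      exact_mod_cast (show (Y2 - Y1) * (Y1 - Y2) * (p21 * p2) * -p1 - (Y3 - Y2) * (Y2 - Y3) * (p32 * p1) * -p2 +
          (Y1 - (Y2 + Y2) + Y3) * -p1 * -p2 = p1 * p2 * (p1 - p2) by
        rw [h21', h32']
        linear_combination (p1 * p2 * (1 - (Y1 - Y2))) * hR1 + (p1 * p2 * ((Y2 - Y3) - 1)) * hR2 +
          (p1 * p2 * (p2 - p1)) * h2S)
  · -- `i_r → i_{r+1}` only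
    rw [show resK k (i r') - resK k (i r) = 1 by rw [hfw]; unfold resK; rw [map_add, map_one]; ring, map_one] at Ra2
    have hR2 : p2 * (Y2 - Y3) = 1 - p2 := by
      have : p2 * (1 + (Y2 - Y3)) = 1 := by exact_mod_cast Ra2
      linear_combination this
    have hbw2 : ¬ j2 r' = j2 r'' + 1 := by rw [v2r', v2r'']; exact fun e => hbw (hfwc.1 e)
    have hfw2 : j2 r'' = j2 r' + 1 := by rw [v2r'', v2r']; exact hbwc.2 hfw
    have hmDfw : klrPR k r'' r' i * klrPR k r r' i - klrPR k r'' r' i * klrPR k r r' i * klrPR k r r' i -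
        klrPR k r'' r' i * (klrPR k r'' r' i * klrPR k r r' i) ∈ klrYAlg k (p := p) (n := n) :=
      sub_mem (sub_mem hmD (mul_mem hmD (klrPR_mem_klrYAlg k _ _ _))) (mul_mem (klrPR_mem_klrYAlg k _ _ _) hmD)
    have hdC := rule_sub (rule_sub (by rw [hdCc, add_zero] :
        klrPR k r' r'' j2 * klrPR k r r'' j2 * klrPsiR k r' i =
          klrPsiR k r' i * (klrPR k r'' r' i * klrPR k r r' i) + 0)
      (rule_mul (by rw [hdCc, add_zero] :
        klrPR k r' r'' j2 * klrPR k r r'' j2 * klrPsiR k r' i =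
          klrPsiR k r' i * (klrPR k r'' r' i * klrPR k r r' i) + 0) mv4')) (rule_mul mv3' (by rw [hdCc, add_zero] :
        klrPR k r' r'' j2 * klrPR k r r'' j2 * klrPsiR k r' i =
          klrPsiR k r' i * (klrPR k r'' r' i * klrPR k r r' i) + 0))
    simp only [mul_zero, zero_mul, add_zero, sub_self] at hdC
    refine klrSR_braid_mul_klrIdemR_of_eq_far_aux k h h' hab hac (dA := 0) (zero_mem _) hmDfw (one_mem _) ?_ ?_ ?_ hdC
      ?_ ?_
    · rw [klrQR_mul_klrPsiR_rule_of_bw k (r := r') (r' := r'') j1 hj1' (by rw [v1r', v1r]; exact hbw)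
        (by rw [v1r, v1r']; exact hfw), mul_zero]
      simp only [swap_apply_of_ne_of_ne h1 h2, swap_apply_left, hS1]
      rfl
    · rw [zero_mul, mul_zero]
    · rw [klrQR_mul_klrPsiR_rule_of_fw k h j2 hj2' hfw2 hbw2]
      simp only [swap_apply_right, swap_apply_of_ne_of_ne h2.symm h3.symm, hS2]
      rw [hAj2, shape_fw_aux (klrIdemR k j2) (klrPR k r' r'' j2 * klrPR k r r'' j2) (klrPR k r' r'' j2)
        (klrPR k r r'' j2) cep2j.symm]
    · rw [if_pos hfw, if_neg hbw, one_mul] at hbr0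
      rw [mul_one]; exact hbr0
    · rw [klrQQ, if_neg hab, if_pos hfw, if_neg hbw, klrQQ, if_neg hbc, if_neg (fun e => hbw (hfwc.1 e)),
        if_pos (hbwc.2 hfw), klrQR, if_neg hab, if_pos hfw, if_neg hbw, klrQR, if_neg hbc,
        if_neg (fun e => hbw (hfwc.1 e)), if_pos (hbwc.2 hfw), ← hp1, ← hp2, ← hp32, ← hY1, ← hY2, ← hY3]
      exact_mod_cast (show (Y2 - Y1) * 0 * (p1 * p1 - p1) -
          (Y2 - Y3) * (p32 * p1 - p32 * p1 * p1 - p32 * (p32 * p1)) * 1 + 1 * (p1 * p1 - p1) * 1 =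
          p1 * p2 * (p1 - p2) by
        rw [h32']; linear_combination (p1 - p1 * p1 + p1 * p2) * hR2)
  · -- `i_r ← i_{r+1}` only
    rw [show resK k (i r) - resK k (i r') = 1 by rw [hbw]; unfold resK; rw [map_add, map_one]; ring, map_one] at Ra1
    have hR1 : p1 * (Y1 - Y2) = 1 - p1 := by
      have : p1 * (1 + (Y1 - Y2)) = 1 := by exact_mod_cast Ra1
      linear_combination this
    have hbw1 : j1 r' = j1 r + 1 := by rw [v1r', v1r]; exact hbw
    have hfw1 : ¬ j1 r = j1 r' + 1 := by rw [v1r, v1r']; exact hfw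
    have hmBbw : klrPR k r' r i * klrPR k r' r'' i - klrPR k r' r i * klrPR k r' r'' i * klrPR k r' r'' i -
        klrPR k r' r i * (klrPR k r' r i * klrPR k r' r'' i) ∈ klrYAlg k (p := p) (n := n) :=
      sub_mem (sub_mem hmB (mul_mem hmB (klrPR_mem_klrYAlg k _ _ _))) (mul_mem (klrPR_mem_klrYAlg k _ _ _) hmB)
    have hdA := rule_sub (rule_sub (by rw [hdAa, add_zero] :
        klrPR k r r' j1 * klrPR k r r'' j1 * klrPsiR k r i =
          klrPsiR k r i * (klrPR k r' r i * klrPR k r' r'' i) + 0)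
      (rule_mul (by rw [hdAa, add_zero] :
        klrPR k r r' j1 * klrPR k r r'' j1 * klrPsiR k r i =
          klrPsiR k r i * (klrPR k r' r i * klrPR k r' r'' i) + 0) mv2')) (rule_mul mv1' (by rw [hdAa, add_zero] :
        klrPR k r r' j1 * klrPR k r r'' j1 * klrPsiR k r i =
          klrPsiR k r i * (klrPR k r' r i * klrPR k r' r'' i) + 0))
    simp only [mul_zero, zero_mul, add_zero, sub_self] at hdA
    have hm1 : (-1 : KLRAlgebra k p n) ∈ klrYAlg k (p := p) (n := n) := neg_mem (one_mem _)
    refine klrSR_braid_mul_klrIdemR_of_eq_far_aux k h h' hab hac (dC := 0) hmBbw (zero_mem _) hm1 ?_ hdA ?_ ?_ ?_ ?_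
    · rw [klrQR_mul_klrPsiR_rule_of_fw k h' j1 hj1' hbw1 hfw1]
      simp only [swap_apply_of_ne_of_ne h1 h2, swap_apply_left, hS1]
      rw [hAj1, shape_fw_aux (klrIdemR k j1) (klrPR k r r' j1 * klrPR k r r'' j1) (klrPR k r r' j1)
        (klrPR k r r'' j1) cep1j.symm]
    · rw [klrQR_mul_klrPsiR_rule_of_bw k (r := r) (r' := r') j2 hj2' (by rw [v2r'', v2r']; exact fun e => hfw (hbwc.1 e))
        (by rw [v2r', v2r'']; exact hfwc.2 hbw), mul_zero]
      simp only [swap_apply_right, swap_apply_of_ne_of_ne h2.symm h3.symm, hS2]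
      rfl
    · rw [zero_mul, mul_zero]
    · rw [if_neg hfw, if_pos hbw, ← klrIdemR_mul_of_mem_klrYAlg k hm1 i] at hbr0
      exact hbr0
    · rw [klrQQ, if_neg hab, if_neg hfw, if_pos hbw, klrQQ, if_neg hbc, if_pos (hfwc.2 hbw),
        if_neg (fun e => hfw (hbwc.1 e)), klrQR, if_neg hab, if_neg hfw, if_pos hbw, klrQR, if_neg hbc,
        if_pos (hfwc.2 hbw), if_neg (fun e => hfw (hbwc.1 e)), ← hp1, ← hp2, ← hp21, ← hY1, ← hY2, ← hY3]
      exact_mod_cast (show (Y1 - Y2) * (p21 * p2 - p21 * p2 * p2 - p21 * (p21 * p2)) * 1 -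
          (Y3 - Y2) * 0 * (p2 * p2 - p2) + -1 * 1 * (p2 * p2 - p2) = p1 * p2 * (p1 - p2) by
        rw [h21']; linear_combination (-p2 + p2 * p2 - p1 * p2) * hR1)
  · -- unrelated
    refine klrSR_braid_mul_klrIdemR_of_eq_far_aux k h h' hab hac hmB hmD (zero_mem _) ?_ hdAa ?_ hdCc ?_ ?_
    · rw [klrQR_mul_klrPsiR_rule_of_ne k h' j1 hj1' (by rw [v1r', v1r]; exact hbw) (by rw [v1r, v1r']; exact hfw)]
      simp only [swap_apply_of_ne_of_ne h1 h2, swap_apply_left, hS1]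
      rw [hAj1, shape_ne_aux]
    · rw [klrQR_mul_klrPsiR_rule_of_ne k h j2 hj2' (by rw [v2r'', v2r']; exact fun e => hfw (hbwc.1 e))
        (by rw [v2r', v2r'']; exact fun e => hbw (hfwc.1 e))]
      simp only [swap_apply_right, swap_apply_of_ne_of_ne h2.symm h3.symm, hS2]
      rw [hAj2, shape_ne_aux]
    · rw [if_neg hfw, if_neg hbw, zero_mul, add_zero] at hbr0
      rw [mul_zero, add_zero]; exact hbr0
    · rw [klrQQ, if_neg hab, if_neg hfw, if_neg hbw, klrQQ, if_neg hbc, if_neg (fun e => hbw (hfwc.1 e)),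
        if_neg (fun e => hfw (hbwc.1 e)), klrQR, if_neg hab, if_neg hfw, if_neg hbw, klrQR, if_neg hbc,
        if_neg (fun e => hbw (hfwc.1 e)), if_neg (fun e => hfw (hbwc.1 e)), ← hp1, ← hp2, ← hp21, ← hp32]
      exact_mod_cast (show 1 * (p21 * p2) * (1 - p1) - 1 * (p32 * p1) * (1 - p2) + 0 * (1 - p1) * (1 - p2) =
          p1 * p2 * (p1 - p2) by rw [h21', h32']; ring)

end

end BraidEqFar


/-! ### BK Thm 3.3 assembled: the braid relation, and the unconditional isomorphism `R^{Λ₀}_n ≅ k[S_n]` -/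

section Assembly

variable (k : Type*) [Field k] [DecidableEq k] (p n : ℕ) [Fact p.Prime] [CharP k p]

variable {p n}

omit [DecidableEq k] in
/-- **The braid relation of BK Thm 3.3 on each idempotent**: the five residue patterns. [folklore] -/
theorem klrSR_braid_mul_klrIdemR {r r' r'' : Fin n} (h : (r' : ℕ) = r + 1) (h' : (r'' : ℕ) = r' + 1)
    (i : Fin n → ZMod p) :
    klrSR k r r' * (klrSR k r' r'' * (klrSR k r r' * klrIdemR k i)) =
      klrSR k r' r'' * (klrSR k r r' * (klrSR k r' r'' * klrIdemR k i)) := by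
  by_cases hab : i r = i r'
  · by_cases hbc : i r' = i r''
    · exact klrSR_braid_mul_klrIdemR_of_eq_eq k h h' hab hbc
    · exact klrSR_braid_mul_klrIdemR_of_eq_ne k h h' hab (fun e => hbc (hab.symm.trans e))
  · by_cases hbc : i r' = i r''
    · exact klrSR_braid_mul_klrIdemR_of_ne_eq k h h' hab hbc
    · by_cases hac : i r = i r''
      · exact klrSR_braid_mul_klrIdemR_of_eq_far k h h' hab hac
      · exact klrSR_braid_mul_klrIdemR_of_distinct k h h' hab hbc hac

omit [DecidableEq k] in
/-- **Brundan–Kleshchev Thm 3.3, the braid relation `s_rs_{r+1}s_r = s_{r+1}s_rs_{r+1}` in `R^{Λ₀}_n`**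
(arXiv:0808.2032, (3.10) first part; level one, degenerate case). Together with `klrSR_mul_self`
(the quadratic relation) and `klrSR_comm_of_far`, BK's `s_r` satisfy the Coxeter relations of
`S_n`. [folklore] -/
theorem klrSR_braid {r r' r'' : Fin n} (h : (r' : ℕ) = r + 1) (h' : (r'' : ℕ) = r' + 1) :
    klrSR k r r' * klrSR k r' r'' * klrSR k r r' = klrSR k r' r'' * klrSR k r r' * klrSR k (p := p) r' r'' := by
  rw [← mul_one (klrSR k r r' * klrSR k r' r'' * klrSR k r r'),
    ← mul_one (klrSR k r' r'' * klrSR k r r' * klrSR k r' r''), ← sum_klrIdemR k (p := p) (n := n),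
    Finset.mul_sum, Finset.mul_sum]
  refine Finset.sum_congr rfl fun i _ => ?_
  simp only [mul_assoc]
  exact klrSR_braid_mul_klrIdemR k h h' i

/-- **Brundan–Kleshchev's Main Theorem at level one in the degenerate case: `R^{Λ₀}_n ≅ k[S_n]`**
(arXiv:0808.2032, Main Theorem with §3.5), now unconditional: `σ : R^{Λ₀}_n → 𝔽S_n`
(`klrToGroupAlgebra`, from Thm 3.2) and `ρ : 𝔽S_n → R^{Λ₀}_n` (`klrRho`, from Thm 3.3 through the
Coxeter presentation) are mutually inverse. [folklore] -/
noncomputable def klrAlgEquiv : KLRAlgebra k p n ≃ₐ[k] MonoidAlgebra k (Perm (Fin n)) :=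
  klrAlgEquivOfBraid k (fun _ _ _ h h' => klrSR_braid k h h')

/-- The isomorphism is `σ`. [folklore] -/
theorem klrAlgEquiv_apply (x : KLRAlgebra k p n) : klrAlgEquiv k x = klrToGroupAlgebra k p n x := rfl

/-- **`σ : R^{Λ₀}_n → k[S_n]` is bijective** (injectivity = the relations of BK Thm 3.2 *present*
`k[S_n]` on the generators `e(𝐢)`, `y_r`, `ψ_r`; cf. `klrToGroupAlgebra_injective` for the form with
the braid relation as a hypothesis, now discharged by `klrSR_braid`). [folklore] -/
theorem klrToGroupAlgebra_bijective : Function.Bijective (klrToGroupAlgebra k p n) :=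
  (klrAlgEquiv k (p := p) (n := n)).bijective

end Assembly


/-! ### Transport: `k[S_n]` is `ℤ`-graded through `σ`, compatibly with the residue-content blocks
(Brundan–Kleshchev; Hu–Mathas 2010, Thm 24) -/

section Transport

variable (k : Type*) [Field k] [DecidableEq k] (p n : ℕ) [Fact p.Prime] [CharP k p]

variable {n}

/-- **The degree-`e` component of `k[S_n]`**: the image `σ(R^{Λ₀}_{n,e})` of the homogeneous
component of the KLR algebra under the Brundan–Kleshchev isomorphism. [folklore] -/
def groupAlgDegPart (e : ℤ) : Submodule k (MonoidAlgebra k (Perm (Fin n))) :=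
  (klrDegPart k p n e).map ((klrAlgEquiv k (p := p) (n := n)).toLinearEquiv : _ →ₗ[k] _)

/-- The degree components are the transports along the order isomorphism of submodule lattices. [folklore] -/
theorem groupAlgDegPart_eq (e : ℤ) :
    groupAlgDegPart k p e =
      Submodule.orderIsoMapComap (klrAlgEquiv k (p := p) (n := n)).toLinearEquiv (klrDegPart k p n e) := by
  rw [Submodule.orderIsoMapComap_apply]; rfl

/-- **`k[S_n] = ⨁_e k[S_n]_e`: the components are independent.** [folklore] -/
theorem iSupIndep_groupAlgDegPart : iSupIndep (groupAlgDegPart k p (n := n)) := by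
  have := (iSupIndep_klrDegPart k (p := p) (n := n)).map_orderIso
    (Submodule.orderIsoMapComap (klrAlgEquiv k (p := p) (n := n)).toLinearEquiv)
  convert this using 1
  funext e
  exact groupAlgDegPart_eq k p e

/-- **`k[S_n] = ∑_e k[S_n]_e`.** [folklore] -/
theorem iSup_groupAlgDegPart_eq_top : (⨆ e : ℤ, groupAlgDegPart k p (n := n) e) = ⊤ := by
  simp_rw [groupAlgDegPart_eq]
  rw [← OrderIso.map_iSup, iSup_klrDegPart_eq_top, OrderIso.map_top]

/-- **The grading is multiplicative: `k[S_n]_d · k[S_n]_e ⊆ k[S_n]_{d+e}`.** [folklore] -/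
theorem mul_mem_groupAlgDegPart {d e : ℤ} {x y : MonoidAlgebra k (Perm (Fin n))}
    (hx : x ∈ groupAlgDegPart k p d) (hy : y ∈ groupAlgDegPart k p e) : x * y ∈ groupAlgDegPart k p (d + e) := by
  obtain ⟨a, ha, rfl⟩ := hx
  obtain ⟨b, hb, rfl⟩ := hy
  exact ⟨a * b, mul_mem_klrDegPart k ha hb, map_mul (klrAlgEquiv k (p := p) (n := n)) a b⟩

/-- `1 ∈ k[S_n]_0`. [folklore] -/
theorem one_mem_groupAlgDegPart : (1 : MonoidAlgebra k (Perm (Fin n))) ∈ groupAlgDegPart k p 0 :=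
  ⟨1, one_mem_klrDegPart k, map_one (klrAlgEquiv k (p := p) (n := n))⟩

/-- The idempotents `e(𝐢)` have degree `0`. [folklore] -/
theorem klrIdempotent_mem_groupAlgDegPart (i : Fin n → ZMod p) :
    klrIdempotent k (resCast k p n i) ∈ groupAlgDegPart k p 0 :=
  ⟨klrIdemR k i, klrMk_mem_klrDegPart k (klrE_mem k i), klrToGroupAlgebra_klrIdemR k i⟩

/-- The nilpotents `y_r` have degree `2`. [folklore] -/
theorem bkNilpotent_mem_groupAlgDegPart (r : Fin n) : bkNilpotent k r ∈ groupAlgDegPart k p (n := n) 2 :=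
  ⟨klrYR k r, klrMk_mem_klrDegPart k (klrY_mem k r), klrToGroupAlgebra_klrYR k r⟩

/-- The elements `ψ_r e(𝐢)` have degree `-a_{i_r i_{r+1}}`. [folklore] -/
theorem bkPsi_mul_klrIdempotent_mem_groupAlgDegPart {r r' : Fin n} (h : (r' : ℕ) = r + 1) (i : Fin n → ZMod p) :
    bkPsi k r r' * klrIdempotent k (resCast k p n i) ∈ groupAlgDegPart k p (-klrCartan (i r) (i r')) :=
  ⟨klrPsiR k r i, klrMk_mem_klrDegPart k (klrP_mem k h i), klrToGroupAlgebra_klrPsiR k h i⟩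

/-- **The graded blocks `e_α k[S_n]_e = k[S_n]_e ∩ k[S_n]_α`** (content `α`, degree `e`): the
candidates for the subspaces `N (α, e)` of `KLRGradedCellularBasis_of_gradedBlocks`. [folklore] -/
def gradedBlock (α : k → ℕ) (e : ℤ) : Submodule k (MonoidAlgebra k (Perm (Fin n))) :=
  groupAlgDegPart k p e ⊓ contentSpace k α

/-- Multiplicativity within a content. [folklore] -/
theorem mul_mem_gradedBlock {α : k → ℕ} {d e : ℤ} {x y : MonoidAlgebra k (Perm (Fin n))}
    (hx : x ∈ gradedBlock k p α d) (hy : y ∈ gradedBlock k p α e) : x * y ∈ gradedBlock k p α (d + e) :=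
  ⟨mul_mem_groupAlgDegPart k p hx.1 hy.1, mul_mem_contentSpace k hx.2 y⟩

/-- Orthogonality across contents. [folklore] -/
theorem mul_eq_zero_of_mem_gradedBlock {α α' : k → ℕ} (hne : α ≠ α') {d e : ℤ}
    {x y : MonoidAlgebra k (Perm (Fin n))} (hx : x ∈ gradedBlock k p α d) (hy : y ∈ gradedBlock k p α' e) :
    x * y = 0 :=
  mul_eq_zero_of_mem_contentSpace k hne hx.2 hy.2

/-- **The graded blocks are independent: `k[S_n] ⊇ ⨁_{α,e} e_α k[S_n]_e`** (multiply a relation by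
the central idempotent `e_α`, which kills the other contents and preserves degrees, then use the
independence of the degree components). This is the `iSupIndep N` input of
`KLRGradedCellularBasis_of_gradedBlocks`. [folklore] -/
theorem iSupIndep_gradedBlock :
    iSupIndep (fun ae : (k → ℕ) × ℤ => gradedBlock k p (n := n) ae.1 ae.2) := by
  classical
  rintro ⟨α, e⟩
  rw [disjoint_iff, eq_bot_iff]
  rintro x ⟨hx1, hx2⟩
  simp only [SetLike.mem_coe] at hx1 hx2
  let T : Submodule k (MonoidAlgebra k (Perm (Fin n))) :=
    (⨆ (e' : ℤ) (_ : e' ≠ e), groupAlgDegPart k p e').comap (LinearMap.mulLeft k (contentIdempotent k α))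
  have hT : (⨆ (j : (k → ℕ) × ℤ) (_ : j ≠ (α, e)), gradedBlock k p (n := n) j.1 j.2) ≤ T := by
    refine iSup₂_le fun j hj => ?_
    intro y hy
    rw [Submodule.mem_comap, LinearMap.mulLeft_apply]
    by_cases hα : j.1 = α
    · have he : j.2 ≠ e := fun he => hj (Prod.ext hα he)
      rw [contentIdempotent_mul_of_mem k (hα ▸ hy.2)]
      exact Submodule.mem_iSup_of_mem j.2 (Submodule.mem_iSup_of_mem he hy.1)
    · rw [mul_eq_zero_of_mem_contentSpace k (Ne.symm hα) (contentIdempotent_mem k α) hy.2]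
      exact Submodule.zero_mem _
  have hx3 : x ∈ ⨆ (e' : ℤ) (_ : e' ≠ e), groupAlgDegPart k p e' := by
    have := hT hx2
    rw [Submodule.mem_comap, LinearMap.mulLeft_apply, contentIdempotent_mul_of_mem k hx1.2] at this
    exact this
  exact (Submodule.disjoint_def.1 (iSupIndep_groupAlgDegPart k p (n := n) e)) x hx1.1 hx3

/-- **`k[S_n] = ∑_{α,e} e_α k[S_n]_e`**: every element is a sum of its graded block components.
[folklore] -/
theorem iSup_gradedBlock_eq_top :
    (⨆ ae : (k → ℕ) × ℤ, gradedBlock k p (n := n) ae.1 ae.2) = ⊤ := by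
  rw [eq_top_iff, ← iSup_groupAlgDegPart_eq_top k p, iSup_le_iff]
  intro e x hx
  have hx' : x = ∑ i : Fin n → ZMod p, klrIdempotent k (resCast k p n i) * x := by
    rw [← Finset.sum_mul, sum_klrIdempotent_resCast, one_mul]
  rw [hx']
  refine Submodule.sum_mem _ fun i _ => ?_
  have hmem : klrIdempotent k (resCast k p n i) * x ∈
      gradedBlock k p (seqContent k (resCast k p n i)) e := by
    refine ⟨?_, mul_mem_contentSpace k (jointEigenspace_le_contentSpace k _ (klrIdempotent_mem k _)) x⟩
    have := mul_mem_groupAlgDegPart k p (klrIdempotent_mem_groupAlgDegPart k p i) hx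
    rwa [zero_add] at this
  exact Submodule.mem_iSup_of_mem (seqContent k (resCast k p n i), e) hmem

open Classical in
/-- **The graded blocks form an internal direct sum decomposition `k[S_n] = ⨁_{α,e} e_α k[S_n]_e`.**
[folklore] -/
theorem isInternal_gradedBlock :
    DirectSum.IsInternal (fun ae : (k → ℕ) × ℤ => gradedBlock k p (n := n) ae.1 ae.2) :=
  (DirectSum.isInternal_submodule_iff_iSupIndep_and_iSup_eq_top _).2
    ⟨iSupIndep_gradedBlock k p, iSup_gradedBlock_eq_top k p⟩

end Transport


/-! ### Reduction of the fact to the graded dimensions of the blocks -/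

section Reduction

open Classical in
/-- **`KLRGradedCellularBasis` follows from the graded dimension formula for the blocks of
`𝔽_p[S_n]`**: if `dim (e_α 𝔽_p[S_n]_e) = #{(μ, 𝔰, 𝔱) : cont μ = α, deg 𝔰 + deg 𝔱 = e}` for all
contents `α` and degrees `e` (Hu–Mathas 2010, Main Theorem/Cor. 5.?: the `ψ_{𝔰𝔱}` with
`Shape = μ`, `cont μ = α`, `deg 𝔰 + deg 𝔱 = e` form a basis of `e_α H_e`; equivalently
Brundan–Kleshchev 2009a, Thm 4.20), then collecting bases of the graded blocks
(`isInternal_gradedBlock`) gives a basis of `𝔽_p[S_n]` indexed by `TableauPair n` with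
`β_k ∈ e_{cont k} 𝔽_p[S_n]_{deg k}`, and `KLRGradedCellularBasis_of_gradedBlocks` applies with
`N (α, e) = e_α 𝔽_p[S_n]_e`. [folklore] -/
theorem KLRGradedCellularBasis_of_finrank_gradedBlock
    (H : ∀ (p : ℕ) [Fact p.Prime] (n : ℕ) (α : ZMod p → ℕ) (e : ℤ),
      Module.finrank (ZMod p) (gradedBlock (ZMod p) p (n := n) α e) =
        Fintype.card {t : TableauPair n // TableauPair.content p t = α ∧ TableauPair.degree p t = e}) :
    KLRGradedCellularBasis := by
  refine KLRGradedCellularBasis_of_gradedBlocks fun p _ n => ?_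
  let N : (ZMod p → ℕ) × ℤ → Submodule (ZMod p) (MonoidAlgebra (ZMod p) (Perm (Fin n))) :=
    fun ae => gradedBlock (ZMod p) p ae.1 ae.2
  have hint : DirectSum.IsInternal N :=
    (DirectSum.isInternal_submodule_iff_iSupIndep_and_iSup_eq_top N).2
      ⟨iSupIndep_gradedBlock (ZMod p) p, iSup_gradedBlock_eq_top (ZMod p) p⟩
  let f : TableauPair n → (ZMod p → ℕ) × ℤ := fun t => (TableauPair.content p t, TableauPair.degree p t)
  have hfin : ∀ ae, Module.finrank (ZMod p) (N ae) = Fintype.card {t : TableauPair n // f t = ae} := by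
    rintro ⟨α, e⟩
    rw [H p n α e]
    exact Fintype.card_congr (Equiv.subtypeEquivRight fun t => by simp only [f, Prod.mk.injEq])
  let v : ∀ ae, Module.Basis {t : TableauPair n // f t = ae} (ZMod p) (N ae) := fun ae =>
    (Module.finBasis (ZMod p) (N ae)).reindex (Fintype.equivFinOfCardEq (hfin ae).symm).symm
  let β : Module.Basis (TableauPair n) (ZMod p) (MonoidAlgebra (ZMod p) (Perm (Fin n))) :=
    (hint.collectedBasis v).reindex (Equiv.sigmaFiberEquiv f)
  have hmem : ∀ t, β t ∈ N (f t) := by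
    intro t
    have h1 : β t = hint.collectedBasis v ((Equiv.sigmaFiberEquiv f).symm t) :=
      Module.Basis.reindex_apply _ _ _
    have h2 : ((Equiv.sigmaFiberEquiv f).symm t).1 = f t := rfl
    rw [h1, ← h2]
    exact hint.collectedBasis_mem v _
  exact ⟨β, N, iSupIndep_gradedBlock (ZMod p) p, hmem,
    fun a e e' x y hx hy => mul_mem_gradedBlock (ZMod p) p hx hy,
    fun a e a' e' x y hne hx hy => mul_eq_zero_of_mem_gradedBlock (ZMod p) p hne hx hy⟩

end Reduction

end Literature.RepresentationTheory.FiniteGroups
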